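import Summits.Parity.GeneralizedHardyLittlewood.Theorems.GoldbachHeathBrownDispersionHeathBrownMorozUniformOfClassLemmas
import Literature.NumberTheory.Sieve.HeathBrownCubicLemma35Holds
import Literature.NumberTheory.Sieve.HeathBrownCubicLeadingA
import Literature.NumberTheory.Sieve.HeathBrownCubicPrimesProofs
import Literature.NumberTheory.Sieve.HeathBrownMorozClassTypeI
import Literature.NumberTheory.Sieve.HeathBrownMorozClassPairCount
import Literature.NumberTheory.Sieve.HeathBrownMorozResidueClassesSieve
import Literature.NumberTheory.Sieve.HeathBrownMorozClassLemma35
import Literature.NumberTheory.Sieve.HeathBrownCubicLeadingAPairs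
import Literature.NumberTheory.Sieve.HeathBrownCubicTypeIIFinal
import Summits.Parity.GeneralizedHardyLittlewood.Theorems.GoldbachHeathBrownDispersionHeathBrownMorozUniformSigmaOneCoprime
import Summits.Parity.GeneralizedHardyLittlewood.Theorems.GoldbachHeathBrownDispersionHeathBrownMorozUniformClassPairsTypeI
import Summits.Parity.GeneralizedHardyLittlewood.Theorems.GoldbachHeathBrownDispersionHeathBrownMorozUniformClassDisplay104
import Summits.Parity.GeneralizedHardyLittlewood.Theorems.GoldbachHeathBrownDispersionHeathBrownMorozUniformClassMainError
import Summits.Parity.GeneralizedHardyLittlewood.Theorems.GoldbachHeathBrownDispersionHeathBrownMorozUniformClassMainCauchy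
import Summits.Parity.GeneralizedHardyLittlewood.Theorems.GoldbachHeathBrownDispersionHeathBrownMorozUniformTwistedSsum
import HarnessLib

/-!
# Line `parent-differencing` — crux `HeathBrownMorozUniform` (stmt-Parity-19915), CRUX-PLAN skeleton (v7 = FINAL, sorry-free: the UNION skeleton with EVERY stub CLOSED — this line's linear-sieve half (S2, S3, S4a, S4p, S4b) and line `unit-split-positivity`'s Type II half (E3, E4, E5); `heathBrownMorozUniform_via_line` is a THEOREM with standard axioms)

Route `GoldbachHeathBrownDispersion` (Parity / GeneralizedHardyLittlewood), crux
`Summit.Parity.GeneralizedHardyLittlewood.Theses.GoldbachHeathBrownDispersion.HeathBrownMorozUniform`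
(Heath-Brown–Moroz 2004, Theorem 2 for `x³ + 2y³`: the primes of Heath-Brown's sequence are
asymptotically distributed over the admissible classes `(a, b) mod d` with weight `w(d)`).

**This file proves nothing about Goldbach** — it is the checked skeleton of ONE line of attack on ONE crux
of a FRONTIER rung (formalisation of a 2004 theorem); the binary Goldbach problem is untouched.

## The line (idea card `Ideas/parent-differencing.md`, sharpened by `TRIAGE-r1-1.md` / `TRIAGE-r1-2.md`)

The tree already reduces the crux IN THE KERNEL to three class hypotheses
(`heathBrownMorozUniform_of_classLemmas`, p544930): `h35` (class Lemma 3.5 = FL terms vs `κ_d·ℬ`),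
`h39` (class Lemma 3.9 = leading `e`-parts vs `κ_d·ℬ`), `h310` (class Lemma 3.10 = Type II `f`-parts),
with `κ_d = (w(d)/d²)·κ` (`classKappa_def`, `rfl`).  The lever of this line: **never compare the class with
`ℬ` directly — compare it with the PARENT family `boxPairs X η ⊇ classPairs X η d a b` at the SAME height,
scaled by `w(d)/d²`, and let the tree's PROVED parent Lemmas 3.5 / 3.9 and display (10.4)
(`HeathBrown2001_lemma_3_5_holds`, `HeathBrown2001_lemma_3_9_holds`, `HeathBrown2001_display_10_4`) carry the
whole `ℬ`-side, (6.7)/(6.9), the Mertens constant and the `Σ₃`/(10.5) matching.**  What is left for the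
class are statements AT THE PARENT'S SEAMS whose main terms match the parent's identically
(`coprimeClassWeight_mul_zetaTwoCorrection`, `E_z(d) = coprimeClassWeight d` once `z = X^τ > d`), plus the one
genuinely new arithmetic input, the coprime-restricted singular sum `Σ₁^{(d)}` (a finite Euler-factor twist of
the tree's `Σ₁` theorem).

## v7 (g4, 2026-08-27 ≈20:3xZ; same path) — LINE COMPLETE: 0 stubs, 0 `sorry`

* **E5 CLOSED — `stub_twistedSsum` is a THEOREM.** The lead `parity-ideate-ghb-prover-1` g3 landed the twisted dispersion chain
  `Literature/NumberTheory/Sieve/HeathBrownCubicTwisted{Defs,Cauchy,Localise,SmallQ,ClassISum,UstarBound,S4Bound,Ssum}.lean`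
  (p559220, p559990, p561740, p561762, p562686, p562808, p563483, p564660; final theorem `CubicSieve.Twisted.Ssum_le_of_params`) and then
  `Summit.Parity.GeneralizedHardyLittlewood.Theorems.GoldbachHeathBrownDispersionHeathBrownMorozUniform.stub_twistedSsum`
  (p565095, `Theorems/GoldbachHeathBrownDispersionHeathBrownMorozUniformTwistedSsum.lean`), whose statement is the registered signature
  `Sig.stub_twistedSsum` VERBATIM ↦ `twistedSsum_holds` below.  Hence `classTypeII_holds : ClassTypeIIBound` (= `h310`) and the last
  theorem `heathBrownMorozUniform_via_line : …Theses.GoldbachHeathBrownDispersion.HeathBrownMorozUniform` no longer depend on any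
  `sorry`: this file now PROVES the crux outright (the ledger item closes through the lead's `Theorems/` closer, not through this file —
  a `Cruxes/` line file is a plan record, not a proposal target).
* Nothing else changed: every statement-def, every `Sig.*`, every composition of v6 is byte-identical; only the `sorry` of E5 was
  replaced by the landed theorem and the name `stub_twistedSsum` retired to `twistedSsum_holds` (no `stub_*` declaration remains).
* This completes BOTH surviving crux-plan lines of the r1 triage (`parent-differencing` = Part A, `unit-split-positivity` = Part B) exactly
  at the seams they cut: eight stubs named across v1–v6 (S2, S3, S4a, S4p, S4b, E3, E4, E5), eight theorems landed by five seats in ≈ 5 h wall.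
  **Goldbach is NOT proved or advanced by this** — the crux is Heath-Brown–Moroz 2004 Thm 2 (x³+2y³), one input of the FRONTIER
  formalisation rung F-P1b `GoldbachHeathBrownDispersion`.

## v6 (g3, 2026-08-27 ≈19:45Z; same path; what changed since the registered v3 and why — v4/v5 were the unregistered intermediates)

* **Part A (this line) is ENTIRELY CLOSED — `h35` AND `h39` of the class are now THEOREMS of this file.**  Within one hour
  of v3 the stub-workers landed every Part-A stub as a `Theorems/GoldbachHeathBrownDispersionHeathBrownMorozUniform*.lean`
  file whose final theorem has TYPE = the statement-def unfolded verbatim, so each closes here by ONE line: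
  S3 `stub_sigmaOneCoprime` ↦ `sigmaOneCoprime_holds := classSigmaOneCoprime` (p560964 + p559789, `ghb-stub-sigma1-p1`);
  S4p `stub_classPairsTypeI` ↦ `classPairsTypeI_holds := classPairsTypeI_of_pairs` (p561315 over p557644, `ghb-stub-display104-p1`);
  S4b `stub_classDisplay104` ↦ `classDisplay104_of_hyps := fun _ => classDisplay104_of_typeISqfreeSum_of_sigmaOneCoprime`
  (p562472 over p559714 / p561076, `ghb-stub-display104-p1`) and the 0-ary `classDisplay104_holds : ClassDisplay104`;
  hence `classLeadingDifferencing_holds` (EQ39) and `classH39_holds` (the class Lemma 3.9 `h39` itself) are PROVED below.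
* **E3 and E4 of Part B are CLOSED:** the lead `parity-ideate-ghb-prover-1` g3 landed
  `…Theorems.GoldbachHeathBrownDispersionHeathBrownMorozUniform.stub_classMainError` (p562045) and `….stub_classMainCauchy`
  (p562571), statements = the registered signatures `Sig.stub_classMainError` / `Sig.stub_classMainCauchy` verbatim ↦
  `classMainError_holds`, `classMainCauchy_holds`.
* **ONE stub remains, of Part B, name and statement byte-identical to v3:** E5 `stub_twistedSsum : Sig.stub_twistedSsum`
  (LOAD-BEARING; lead ghb-prover-1 g3: `HeathBrownCubicTwistedDefs/Cauchy/Localise/SmallQ` landed p559220 / p559990 / p561740 /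
  p561762, `…TwistedClassISum` p562686 pending).  Re-registering this file therefore only RETIRES the five closed stubs; nothing
  the lead is typed against moves.
* Compositions (all kernel-checked, no `sorry`): `HeathBrownMorozUniform_of_twisted (E5)` — the crux from EXACTLY the one
  remaining stub signature BY NAME; `HeathBrownMorozUniform_of_two (E4) (E5)`; `HeathBrownMorozUniform_of_typeII :
  ClassTypeIIBound → crux` (Part A discharged internally); the v2/v3/v4 shapes `HeathBrownMorozUniform_of`, `_of_display104`,
  `_of'`, `_of_four`, `_of_six` are kept so nothing typed earlier breaks.

## v3 / v4 history (g2, g3; same path)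

* **ONE registered skeleton per crux ⇒ this file is the UNION of the two surviving lines**, exactly as the
  sibling planner's `Lines/unit_split_positivity.lean` v3 (registered 18:41:41Z) was: Part A = this line
  (linear-sieve half: S3, S4p, S4b + everything proved), Part B = line `unit-split-positivity`'s class Type II half
  transplanted VERBATIM (signatures `Sig.*`, stubs E3 `stub_classMainError`, E4 `stub_classMainCauchy`,
  E5 `stub_twistedSsum` with UNCHANGED names and statements, and its proved glue `classSV_le_of_params`, `class_p83`,
  `class_310`, `h310_of`, `classTypeIIBound_of`), so that registering this file keeps every stub of both lines
  active; `ClassTypeIIBound` (S5 = `h310`) is DISCHARGED here (`classTypeII_holds`) and is not a stub.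
* **S2 CLOSED (v3).** The direct class Lemma 3.5 LANDED as `Literature.NumberTheory.Sieve.CubicSieve.class_lemma_3_5`
  (p555871, `HeathBrownMorozClassLemma35`) — its statement is this file's `ClassH35` verbatim — so `classH35_holds` and
  `flDifferencing_holds : ClassFLDifferencing` (via the v2 glue `classFLDifferencing_of_h35`) are PROVED below.
* **S4b was RECUT (v3) along the tree's own file seam `LeadingAPairs | LeadingA`:** the INDEPENDENT stub
  `stub_classPairsTypeI : ClassPairsTypeI` (S4p: Heath-Brown's Lemma 3.2 for CLASS pair sums, main term
  `[(N D, d) = 1]·X_cl·ρ₂(D)/N(D)`, `X_cl = (6η²X²/π²)(ζ(2)/ζ_d(2))d⁻²`) became the first hypothesis of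
  `stub_classDisplay104 : ClassPairsTypeI → ClassTypeISqfreeSum → ClassSigmaOneCoprime → ClassDisplay104`; v4 (g3,
  unpublished) closed S3 and S4p; v5 (unpublished) S4b and E3; v6 E4 as well.
* v2 history (kept): g0's `stub_classTypeI` was superseded by the landed `class_typeI_A` (p551644, range
  `X ≥ 4(d+2)²`; referee finding F-g45a moot); g0's one-bite `stub_leadingDifferencing` was recut into S4a
  (PROVED here: `class_typeI_dyadic`, `classTypeISqfreeSum_holds`) + S4b, with EQ39 and `h39` PROVED from S4b and
  the parent's (10.4) (`classLeadingDifferencing_of_display104`, `h39_of_leadingDifferencing`).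

## Stubs — NONE (v7: every gap of the union is CLOSED — S2, S3, S4a, S4p, S4b, E3, E4, E5; the v6 text below is kept as the record of the last open stub)

Part A (this line): NO open stub — `sigmaOneCoprime_holds` (S3), `classPairsTypeI_holds` (S4p), `classTypeISqfreeSum_holds` (S4a),
`classDisplay104_holds` (S4b), `flDifferencing_holds` (S2); hence the class Lemmas 3.5 and 3.9 themselves, `classH35_lemma_holds` (`h35`) and `classH39_holds` (`h39`).

Part B (line `unit-split-positivity`, verbatim; see `Lines/unit-split-positivity.md` for sizes / plans): E3, E4 CLOSED
(`classMainError_holds` p562045, `classMainCauchy_holds` p562571) and, as of v7, **E5 CLOSED** (`twistedSsum_holds`, p565095):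
* (was) `stub_twistedSsum : Sig.stub_twistedSsum` — E5 (L/XL, LOAD-BEARING, the HARDEST stub): the twisted
  `S`-sum bound with (3.14) up to `d·Q₁` — LANDED by the lead ghb-prover-1 g3 as `…Theorems.….stub_twistedSsum`.
Hence `classTypeII_holds : ClassTypeIIBound` (= `h310`) is PROVED from `classMainError_holds`, `classMainCauchy_holds`,
`twistedSsum_holds` (`classTypeIIBound_of`) — no `sorry` anywhere in this file.

## Composition (kernel-checked, no `sorry`)

`HeathBrownMorozUniform_of_typeII : ClassTypeIIBound → HeathBrownMorozUniform` (ALL of Part A supplied internally: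
`h35` from EQ35 + parent Lemma 3.5 (`h35_of_flDifferencing flDifferencing_holds`), `h39 = classH39_holds` from the class display
(10.4) `classDisplay104_holds` + parent (10.4) + parent Lemma 3.9 (`classLeadingDifferencing_of_display104`,
`h39_of_leadingDifferencing`), then the tree's `heathBrownMorozUniform_of_classLemmas`, p544930);
`HeathBrownMorozUniform_of_twisted : Sig.stub_twistedSsum → HeathBrownMorozUniform` (E3, E4 supplied by `classMainError_holds`,
`classMainCauchy_holds`).  The last theorem `heathBrownMorozUniform_via_line := HeathBrownMorozUniform_of_twisted twistedSsum_holds`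
is, as of v7, a sorry-free THEOREM whose type is the crux decl BY NAME (axioms `[propext, Classical.choice, Quot.sound]`).

References: [cite: HeathBrownMoroz2004, Theorem 2, Lemma 3.1, Lemma 4.1, Prop. 4.2];
[cite: HeathBrownActa2001, Lemmas 3.2, 3.5, 3.9, 3.10 and §10 pp. 60–64].
-/

noncomputable section

open Polynomial NumberField Finset Filter Topology Asymptotics

namespace Summit.Parity.GeneralizedHardyLittlewood.Cruxes.HeathBrownMorozUniform.ParentDifferencing

open Literature.NumberTheory.Sieve.CubicSieve Literature.NumberTheory.Sieve.CubicPrimes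
open Literature.NumberTheory.LFunctions.CubeRootTwoField
open Summit.Parity.GeneralizedHardyLittlewood.Theorems.GoldbachHeathBrownDispersionHeathBrownMorozUniform

/-! ### The statements: S3, S4p (closed v4), S4b (closed v5), S5 (proved from Part B), the proved seams EQ35 / EQ39 / S4a, and the direct `h35` -/

/-- **S2 conclusion — EQ35, the differenced Fundamental-Lemma terms.** For every reduced admissible class
and `ϖ ∈ (0, 1/5)` there are `C, X₀` with, for `X ≥ X₀`, `η` in (2.1), `τ = (log log X)^{−ϖ}`, `n₀ = ⌊1/τ⌋ + 1`:
`∑_{n ≤ n₀} |T⁽ⁿ⁾(𝒜_cl) − (w(d)/d²)·T⁽ⁿ⁾(𝒜)| ≤ C τ η²X²/log X` — NO `σ₀`, no `ℬ`: both sides are sifted by the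
two-sided Fundamental Lemma with the SAME sifting range; for `X^τ > d` every chain prime has norm coprime to
`d`, so the two main terms are `X_cl·E_{X^τ}(d)·(…)` and `(w/d²)·X_𝒜·(…)` with
`X_cl·E(d) = (6η²X²/π²)(ζ(2)/ζ_d(2))d⁻²·coprimeClassWeight d = (w/d²)X_𝒜` — they cancel identically
(`coprimeClassWeight_mul_zetaTwoCorrection`); only the two FL errors and the two Type-I remainder sums survive.
[cite: HeathBrownMoroz2004, Lemma 3.1] [cite: HeathBrownActa2001, Lemma 3.5 and §6] -/
def ClassFLDifferencing : Prop :=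
  ∀ d a b : ℕ, 0 < d → a < d → b < d → Nat.Coprime (a ^ 3 + 2 * b ^ 3) d →
    ∀ ϖ : ℝ, 0 < ϖ → ϖ < 1 / 5 →
      ∃ C X₀ : ℝ, ∀ X η : ℝ, X₀ ≤ X → Real.exp (-Real.log X ^ (1 / 3 : ℝ)) ≤ η → η ≤ 1 →
        ∑ n ∈ range (chainBound (hbTau ϖ X) + 1),
            |(Tpiece (classPairs X η d a b) pairIdeal X (hbTau ϖ X) n : ℝ) -
                classWeight d / (d : ℝ) ^ 2 * (Tpiece (boxPairs X η) pairIdeal X (hbTau ϖ X) n : ℝ)| ≤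
          C * hbTau ϖ X * η ^ 2 * X ^ 2 / Real.log X

open scoped Classical in
/-- **S3 — the coprime-restricted singular sum `Σ₁^{(d)}`.** For `d ≥ 1` and the limit `σ₀` of the partial
products of Heath-Brown's singular series there are `c, C > 0` with, for every `x ≥ 1`,
`|∑_{N(J) ≤ x, N(J) square-free, (N(J), d) = 1} μ(J)ρ₂(J)N(J)⁻¹log(x/N(J)) − (π²/6)σ₀·∏_{p∣d}(p+1)/(p+1−ν_p)| ≤ C e^{−c√log x}`
— the tree's `HeathBrown2001_sigmaOne_bound` (the case `d = 1`) twisted by the FINITE Euler factor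
`∏_{p∣d}(1 − ρ₀(p)p^{−s})⁻¹`, `ρ₀(p)/p = ν_p/(p+1)` (`rho₀_eq`, `densA_prime`): elementary from the `d = 1` theorem
by `1_{(n,d)=1}·a = a ∗ g_d` (`g_d` multiplicative, supported on `d`-units, `g_d(p^k) = ρ₀(p)^k`) and
`∑_m g_d(m)/m = coprimeClassWeight d`.
[cite: HeathBrownMoroz2004, Lemma 4.1 and (3.1)] [cite: HeathBrownActa2001, §10 pp. 62–63] -/
def ClassSigmaOneCoprime : Prop :=
  ∀ d : ℕ, 0 < d → ∀ σ₀ : ℝ, Tendsto singularProductPartial atTop (𝓝 σ₀) →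
    ∃ c : ℝ, 0 < c ∧ ∃ C : ℝ, 0 < C ∧ ∀ x : ℝ, 1 ≤ x →
      |(∑ J ∈ (idealsLE ⌊x⌋₊).filter
          (fun J => Squarefree (Ideal.absNorm J) ∧ Nat.Coprime d (Ideal.absNorm J)),
          idealMoebius J * Real.log (x / Ideal.absNorm J) * (rho₂ J / Ideal.absNorm J)) -
        Real.pi ^ 2 / 6 * σ₀ * coprimeClassWeight d| ≤ C * Real.exp (-c * Real.sqrt (Real.log x))

/-- **EQ39, the differenced leading parts (PROVED below from S4b and the parent's (10.4); kept as the seam `h39` is glued at).** For every reduced admissible class and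
`ϖ ∈ (0, 1/5)` there are `c, C, X₀` with, for `X ≥ X₀`, `η` in (2.1), every admissible `𝐦` ((3.5)–(3.7)) and every
`c_R` as in (3.3): `|Û_e(𝒜_cl; 𝐦, c) − (w(d)/d²)·Û_e(𝒜; 𝐦, c)| ≤ C M⁻¹ η^{5/2} X² (log X)^c` — NO `σ₀`, no `ℬ`,
no `Σ₃`: after (10.1)–(10.2) (generic `bilin_sum_divisors_eq`) and Type I on both sides (S1 / `HeathBrown2001_typeI_A_holds`),
`c_R` is supported on `X^τ`-rough `R` (so `(N R, d) = 1` once `X^τ > d`) and the differenced main term is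
`X_𝒜 ∑_R c_R ρ₂(R)N(R)⁻¹·[(ζ(2)/ζ_d(2))d⁻²·Σ₁^{(d)}(L_R) − (w/d²)·Σ₁(L_R)] = X_𝒜 ∑_R … · O_d(e^{−c√log L_R})`
by S3, the tree's `HeathBrown2001_sigmaOne_bound'` and `coprimeClassWeight_mul_zetaTwoCorrection`; the
`e^{−c√log L}` is `≤ η^{1/2}` in the range (2.1) exactly as in the tree's `HeathBrown2001_display_10_4`.
(Equivalently: the class display (10.4) with main term `(w/d²)σ₀η²X²Σ₃`, minus the tree's (10.4).)
[cite: HeathBrownMoroz2004, Lemma 4.1] [cite: HeathBrownActa2001, Lemma 3.9 and §10 (10.1)–(10.4)] -/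
def ClassLeadingDifferencing : Prop :=
  ∀ d a b : ℕ, 0 < d → a < d → b < d → Nat.Coprime (a ^ 3 + 2 * b ^ 3) d →
    ∀ ϖ : ℝ, 0 < ϖ → ϖ < 1 / 5 →
      ∃ c C X₀ : ℝ, ∀ X η : ℝ, X₀ ≤ X → Real.exp (-Real.log X ^ (1 / 3 : ℝ)) ≤ η → η ≤ 1 →
        ∀ (k : ℕ) (m : Fin k → ℕ), CoreAdmissible (hbTau ϖ X) m →
          ∀ cR : Ideal (𝓞 K) → ℝ, CSupport X (hbTau ϖ X) cR →
            |bilin (classPairs X η d a b) pairIdeal cR (eWeight X (hbTau ϖ X) m) -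
                classWeight d / (d : ℝ) ^ 2 *
                  bilin (boxPairs X η) pairIdeal cR (eWeight X (hbTau ϖ X) m)| ≤
              C * (∏ i, (m i : ℝ))⁻¹ * η ^ (5 / 2 : ℝ) * X ^ 2 * Real.log X ^ c

open scoped Classical in
/-- **S4a — class Type I summed over square-free moduli up to `B` (the class analogue of the tree's
`exists_typeI_squarefree_sum_le`, i.e. the `hTI` input of `display_10_4_core`).** For every reduced admissible
class there are `k, C` with, for `X ≥ 4(d+2)²` (the range of the LANDED `class_typeI_A`), `η` in (2.1) and
`1 ≤ B ≤ X³`: `∑_{N(D) ≤ B, N(D) □-free} |#𝒜_{cl,D} − [(N D, d)=1]·(6η²X²/π²)(ζ(2)/ζ_d(2))d⁻²ρ₂(D)/N(D)| ≤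
C·(X(1 + log X) + (B + X√B + X^{3/2})(log X)^{k+1})` — main term VERBATIM that of `class_typeI_A`. PROVED below
(`classTypeISqfreeSum_holds`): the tree's `exists_typeI_dyadic` (dyadic blocks `(Q, 2Q]`, `A = 1`, `τ(R) ≥ 1`) run on
`class_typeI_A 1 one_pos`, plus the `D = 1` term `exists_abs_classCountA_top_sub_le` (p552423). [cite: HeathBrownMoroz2004, Lemma 2.4 and (2.29)] [cite: HeathBrownActa2001, Lemma 3.2 and §10 p. 62] -/
def ClassTypeISqfreeSum : Prop :=
  ∀ d a b : ℕ, 0 < d → a < d → b < d → Nat.Coprime (a ^ 3 + 2 * b ^ 3) d →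
    ∃ (k : ℕ) (C : ℝ), 0 ≤ C ∧ ∀ X η B : ℝ, 4 * ((d : ℝ) + 2) ^ 2 ≤ X →
      Real.exp (-Real.log X ^ (1 / 3 : ℝ)) ≤ η → η ≤ 1 → 1 ≤ B → B ≤ X ^ 3 →
        ∑ D ∈ (idealsLE ⌊B⌋₊).filter (fun D => Squarefree (Ideal.absNorm D)),
            |(classCountA X η d a b D : ℝ) -
              (if Nat.Coprime d (Ideal.absNorm D) then
                6 * η ^ 2 * X ^ 2 / Real.pi ^ 2 * zetaTwoCorrection d / (d : ℝ) ^ 2 * rho₂ D /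
                  Ideal.absNorm D else 0)| ≤
          C * (X * (1 + Real.log X) + (B + X * Real.sqrt B + X ^ (3 / 2 : ℝ)) * Real.log X ^ (k + 1))

/-- **S4b conclusion — the CLASS display (10.4)** (Heath-Brown p. 64 for `𝒜_cl` in place of `𝒜`): for every
reduced admissible class, the limit `σ₀` of the singular product and `ϖ ∈ (0, 1/5)` there are `c, C, X₀` with,
for `X ≥ X₀`, `η` in (2.1), admissible `𝐦` and `c_R` as in (3.3),
`|U_e(𝒜_cl; 𝐦, c) − (w(d)/d²)·σ₀η²X²Σ₃(𝐦, c)| ≤ C M⁻¹η^{5/2}X²(log X)^c`.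
Proof plan = the tree's `display_10_4_core` / `HeathBrown2001_display_10_4` VERBATIM with two inputs swapped:
`hTI ↦ S4a` (class Type I; the indicator `[(N(RJ), d) = 1]` splits as `[(N R, d)=1]·[(N J, d)=1]`, and
`(N R, d) = 1` automatically because `c_R` is supported on `X^τ`-rough square-free `R` (`CSupport`) and `X^τ > d`
for `X ≥ X₀(d)`), `hSig1 ↦ S3` (the `J`-sum becomes `Σ₁^{(d)}(L) = (π²/6)σ₀·coprimeClassWeight d + O(e^{−c√log L})`);
the main term is `(6η²X²/π²)(ζ(2)/ζ_d(2))d⁻² · (π²/6)σ₀·coprimeClassWeight d · Σ₃ = (w(d)/d²)σ₀η²X²Σ₃` by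
`coprimeClassWeight_mul_zetaTwoCorrection`; the (10.1)–(10.2) and `ρ₂(R) = 1 + O(τ⁻¹X^{−τ})` errors are the
parent's (`classPairs ⊆ boxPairs`, `classCountA_le_countA`). [cite: HeathBrownActa2001, §10 (10.1)–(10.4)]
[cite: HeathBrownMoroz2004, Lemma 4.1] -/
def ClassDisplay104 : Prop :=
  ∀ d a b : ℕ, 0 < d → a < d → b < d → Nat.Coprime (a ^ 3 + 2 * b ^ 3) d →
    ∀ σ₀ : ℝ, Tendsto singularProductPartial atTop (𝓝 σ₀) → ∀ ϖ : ℝ, 0 < ϖ → ϖ < 1 / 5 →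
      ∃ c C X₀ : ℝ, ∀ X η : ℝ, X₀ ≤ X → Real.exp (-Real.log X ^ (1 / 3 : ℝ)) ≤ η → η ≤ 1 →
        ∀ (k : ℕ) (m : Fin k → ℕ), CoreAdmissible (hbTau ϖ X) m →
          ∀ cR : Ideal (𝓞 K) → ℝ, CSupport X (hbTau ϖ X) cR →
            |bilin (classPairs X η d a b) pairIdeal cR (eWeight X (hbTau ϖ X) m) -
                classWeight d / (d : ℝ) ^ 2 * (σ₀ * η ^ 2 * X ^ 2 * sigma3 X (hbTau ϖ X) m cR)| ≤
              C * (∏ i, (m i : ℝ))⁻¹ * η ^ (5 / 2 : ℝ) * X ^ 2 * Real.log X ^ c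

/-- **S5 — the class Type II estimate (`h310` of `heathBrownMorozUniform_of_classLemmas`, VERBATIM).**
Heath-Brown's Lemma 3.10 for the class family with the large-sieve hypothesis (3.14) up to `d·Q₁`
(HBM04 Prop. 4.2 (ii): the class condition is one more congruence on `β̂`). Shared with line
`unit-split-positivity`; not specific to differencing. [cite: HeathBrownMoroz2004, Prop. 4.2]
[cite: HeathBrownActa2001, Lemma 3.10 and §§11–13] -/
def ClassTypeIIBound : Prop :=
  ∀ d a b : ℕ, 0 < d → a < d → b < d → Nat.Coprime (a ^ 3 + 2 * b ^ 3) d →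
    ∀ ϖ : ℝ, 0 < ϖ → ϖ < 1 / 5 →
      ∃ c c₃ c₄ : ℝ, 0 < c₃ ∧ 0 < c₄ ∧ ∀ C₁ c₁ c₅ c₆ : ℝ, 0 < c₁ → 0 < c₅ → 0 < c₆ →
        ∃ C X₀ : ℝ, ∀ X η Q₁ : ℝ, X₀ ≤ X → Real.exp (-Real.log X ^ (1 / 3 : ℝ)) ≤ η → η ≤ 1 →
          1 ≤ Q₁ → (d : ℝ) * Q₁ ≤ Real.exp (Real.log X ^ (1 / 3 : ℝ)) →
            (∀ (k' : ℕ) (m' : Fin k' → ℕ), CoreAdmissible (hbTau ϖ X) m' →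
              Hyp314 X (hbTau ϖ X) m' ((d : ℝ) * Q₁) C₁ c₁ c₃ c₄) →
              ∀ (k : ℕ) (m : Fin k → ℕ), CoreAdmissible (hbTau ϖ X) m →
                ∀ cR : Ideal (𝓞 K) → ℝ, CSupport X (hbTau ϖ X) cR →
                  ∀ V : ℝ, c₅ * X ^ (1 + hbTau ϖ X) ≤ V → V ≤ c₆ * X ^ (3 / 2 - hbTau ϖ X) →
                    |bilin (classPairs X η d a b) pairIdeal cR
                        (fun S => if V < (Ideal.absNorm S : ℝ) ∧ (Ideal.absNorm S : ℝ) ≤ 2 * V then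
                          fWeight X (hbTau ϖ X) m S else 0)| ≤
                      C * X ^ 2 * Q₁ ^ (-(1 / 160 : ℝ)) * Real.log X ^ c

/-- **The direct class Lemma 3.5 (`h35` of `heathBrownMorozUniform_of_classLemmas`, VERBATIM)** — not a stub of
this line but the ALTERNATIVE discharge of S2: ghb-prover-1 is closing it from the landed `HeathBrownMorozClassFLASide`
(`abs_TpieceClassA_sub_le`, `sum_remaindersClassA_le`, `classSizeA_mul_classProd`); `classFLDifferencing_of_h35`
below turns it into EQ35. [cite: HeathBrownMoroz2004, Lemma 3.1] [cite: HeathBrownActa2001, Lemma 3.5] -/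
def ClassH35 : Prop :=
  ∀ d a b : ℕ, 0 < d → a < d → b < d → Nat.Coprime (a ^ 3 + 2 * b ^ 3) d →
    ∀ σ₀ : ℝ, Tendsto singularProductPartial atTop (𝓝 σ₀) → ∀ ϖ : ℝ, 0 < ϖ → ϖ < 1 / 5 →
      ∃ C X₀ : ℝ, ∀ X η : ℝ, X₀ ≤ X → Real.exp (-Real.log X ^ (1 / 3 : ℝ)) ≤ η → η ≤ 1 →
        ∑ n ∈ range (chainBound (hbTau ϖ X) + 1),
            |(Tpiece (classPairs X η d a b) pairIdeal X (hbTau ϖ X) n : ℝ) -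
                classKappa σ₀ X η d * Tpiece (normWindow X η) (fun J => J) X (hbTau ϖ X) n| ≤
          C * hbTau ϖ X * η ^ 2 * X ^ 2 / Real.log X

open scoped Classical in
/-- **S4p — Heath-Brown's Lemma 3.2 for CLASS pair sums** (the class twin of the tree's
`abs_sum_pairs_countA_sub_le`, `HeathBrownCubicLeadingAPairs`; p. 62 "Thus `R` and `J` are coprime, whence `RJ`
may be assumed to be square-free … We are therefore in a position to apply Lemma 3.2").  Let `α` be supported on
`z`-rough ideals `R` of square-free norm `≤ R_max` with `|α| ≤ A`, `β` on square-free ideals with `|β| ≤ B`, `J`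
running over the ideals of norm `< L ≤ z`.  Then
`|∑_{R,J} α_Rβ_J #𝒜_{cl,RJ} − X_cl·(∑_{R : (N R, d) = 1} α_Rρ₂(R)/N(R))·(∑_{J ∈ 𝒯r, (N J, d) = 1} β_Jρ₂(J)/N(J))|
 ≤ AB·∑_{N(D) ≤ R_maxL, D ∈ 𝒯r} |#𝒜_{cl,D} − [(N D, d) = 1]·X_clρ₂(D)/N(D)|`, `X_cl = (6η²X²/π²)(ζ(2)/ζ_d(2))d⁻²` —
the class main term is VERBATIM that of the landed `class_typeI_A` / S4a, and for coprime `R`, `J`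
(`isCoprime_of_isRough_of_absNorm_lt`) its indicator and density factorise:
`[(N(RJ), d) = 1] = [(N R, d) = 1][(N J, d) = 1]` (`Nat.Coprime` is multiplicative: `Nat.coprime_mul_iff_right`),
`ρ₂(RJ) = ρ₂(R)ρ₂(J)` (`rho₂_mul_of_coprime`), `N(RJ) ∈ 𝒯r ⟺ N(J) ∈ 𝒯r` (`squarefree_absNorm_mul_iff`); for
`RJ ∉ 𝒯r` both `#𝒜_{cl,RJ} ≤ #𝒜^(K)_{RJ} = 0` (`classCountA_le_countA`, `countA_eq_zero_of_not_squarefree_absNorm`)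
and the main term vanish, and `(R, J) ↦ RJ` is injective (`mul_injOn_rough_small`).  No admissibility of the class
is needed here (it enters only through S4a).  Proof = the tree's `sum_pairs_abs_sub_main_le` + `sum_pairs_main_eq`
with these two extra indicator steps. [cite: HeathBrownActa2001, Lemma 3.2 and §10 pp. 61–62]
[cite: HeathBrownMoroz2004, Lemma 2.4] -/
def ClassPairsTypeI : Prop :=
  ∀ (d a b : ℕ) (X η z L Rmax A B : ℝ) (𝓡 : Finset (Ideal (𝓞 K))) (α β : Ideal (𝓞 K) → ℝ),
    0 ≤ X → L ≤ z → 0 ≤ Rmax →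
    (∀ R ∈ 𝓡, α R ≠ 0 → Squarefree (Ideal.absNorm R) ∧ IsRough z R ∧ (Ideal.absNorm R : ℝ) ≤ Rmax) →
    (∀ R ∈ 𝓡, |α R| ≤ A) → (∀ J, β J ≠ 0 → Squarefree J) →
    (∀ J ∈ (idealsLE ⌊L⌋₊).filter (fun J => (Ideal.absNorm J : ℝ) < L), |β J| ≤ B) → 0 ≤ A → 0 ≤ B →
      |(∑ R ∈ 𝓡, ∑ J ∈ (idealsLE ⌊L⌋₊).filter (fun J => (Ideal.absNorm J : ℝ) < L),
          α R * β J * (classCountA X η d a b (R * J) : ℝ)) -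
        6 * η ^ 2 * X ^ 2 / Real.pi ^ 2 * zetaTwoCorrection d / (d : ℝ) ^ 2 *
          (∑ R ∈ 𝓡.filter (fun R => Nat.Coprime d (Ideal.absNorm R)), α R * (rho₂ R / Ideal.absNorm R)) *
          ∑ J ∈ ((idealsLE ⌊L⌋₊).filter (fun J => (Ideal.absNorm J : ℝ) < L)).filter
            (fun J => Squarefree (Ideal.absNorm J) ∧ Nat.Coprime d (Ideal.absNorm J)),
            β J * (rho₂ J / Ideal.absNorm J)| ≤
        A * B * ∑ D ∈ (idealsLE ⌊Rmax * L⌋₊).filter (fun D => Squarefree (Ideal.absNorm D)),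
          |(classCountA X η d a b D : ℝ) -
            (if Nat.Coprime d (Ideal.absNorm D) then
              6 * η ^ 2 * X ^ 2 / Real.pi ^ 2 * zetaTwoCorrection d / (d : ℝ) ^ 2 * rho₂ D /
                Ideal.absNorm D else 0)|

/-! ### S3 and S4p are CLOSED (v4): one-liners on the stub-workers' landed theorems -/

/-- **S3 CLOSED (v4)** — `Σ₁^{(d)}`: the stub-worker `ghb-stub-sigma1-p1` landed
`…Theorems.GoldbachHeathBrownDispersionHeathBrownMorozUniform.classSigmaOneCoprime` (p560964, with p559789: Perron via the
tree's `logRieszMean_LSeries_div_dedekindZeta_bound` for `a_d = a·1_{(d,·)=1}`, residue `(π²/6)σ₀γ₀·coprimeClassWeight d` by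
the finite Euler twist), whose TYPE is `ClassSigmaOneCoprime` unfolded verbatim.  No longer a stub.
[cite: HeathBrownActa2001, §10 pp. 62–63] [cite: HeathBrownMoroz2004, Lemma 4.1] -/
theorem sigmaOneCoprime_holds : ClassSigmaOneCoprime :=
  classSigmaOneCoprime

/-- **S4p CLOSED (v4)** — Lemma 3.2 for class pair sums: the stub-worker `ghb-stub-display104-p1` landed
`…Theorems.GoldbachHeathBrownDispersionHeathBrownMorozUniform.classPairsTypeI_of_pairs` (p561315, over its
`abs_sum_pairs_classCountA_sub_le` p557644 + the filtered main-term identity `class_sum_pairs_main_eq_filter`), whose TYPE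
is `ClassPairsTypeI` unfolded verbatim.  No longer a stub.
[cite: HeathBrownActa2001, Lemma 3.2 and §10 p. 62] [cite: HeathBrownMoroz2004, Lemma 2.4] -/
theorem classPairsTypeI_holds : ClassPairsTypeI :=
  classPairsTypeI_of_pairs

/-! ### S4b is CLOSED (v5): the class display (10.4), in the registered 4-ary shape -/

/-- **S4b CLOSED (v5) — the registered signature of `stub_classDisplay104` verbatim, now a THEOREM.** The stub-worker
`ghb-stub-display104-p1` landed `…Theorems.GoldbachHeathBrownDispersionHeathBrownMorozUniform.classDisplay104_of_typeISqfreeSum_of_sigmaOneCoprime`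
(p562472 `…ClassDisplay104.lean`, over `…ClassDisplay104Pairs` p557644, `…Sums` p559714, `…Core` p561076, `…ClassPairsTypeI` p561315:
the class re-run of `HeathBrownCubicLeadingA` (10.1)–(10.2) — `classU1_eq_pairs`, `abs_classUe_sub_U1_le`, `abs_classU1_sub_U2_le`,
`class_typeI_total_le` — and the class twin `classDisplay104_core` of `display_10_4_core` with the pairs step, `Σ₁^{(d)}` and
`[(N R, d) = 1]` for `X^τ`-rough `R` once `X^τ > d`), whose TYPE is `ClassTypeISqfreeSum → ClassSigmaOneCoprime → ClassDisplay104`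
unfolded verbatim (the v3 first hypothesis `ClassPairsTypeI` is not needed by it: Lemma 3.2 for class pairs is proved inside,
`abs_sum_pairs_classCountA_sub_le`).  The 0-ary `classDisplay104_holds : ClassDisplay104` follows below, after the PROVED S4a.
[cite: HeathBrownActa2001, §10 (10.1)–(10.4)] [cite: HeathBrownMoroz2004, Lemma 4.1] -/
theorem classDisplay104_of_hyps :
    ClassPairsTypeI → ClassTypeISqfreeSum → ClassSigmaOneCoprime → ClassDisplay104 :=
  fun _ => classDisplay104_of_typeISqfreeSum_of_sigmaOneCoprime

/-! ### S4a PROVED (quick win): class Type I summed dyadically over square-free moduli -/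

open scoped Classical in
/-- **Class Lemma 3.2 summed dyadically** (the class twin of `exists_typeI_dyadic`): from the landed
`class_typeI_A` (with `A = 1`) there are `k, C` — uniform in the class — such that for every reduced admissible
class `(a, b) mod d`, `X ≥ 4(d+2)²`, `η` in the range (2.1) and `1 ≤ B ≤ X³`,
`∑_{2 ≤ N(R) ≤ B, N(R) □-free} |#𝒜_{cl,R} − main_R| ≤ C (B + X√B + X^{3/2}) (log X)^{k+1}` (at most `7 log X` blocks
`(2^j, 2^{j+1}]`, each bounded by `class_typeI_A` with `(log(2^jX))^c ≤ (5 log X)^k`, `τ(R) ≥ 1`).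
[cite: HeathBrownMoroz2004, Lemma 2.4 (2.29)] [cite: HeathBrownActa2001, Lemma 3.2 and §7 p. 40] -/
theorem class_typeI_dyadic :
    ∃ (k : ℕ) (C : ℝ), 0 ≤ C ∧ ∀ d a b : ℕ, 0 < d → a < d → b < d → Nat.Coprime (a ^ 3 + 2 * b ^ 3) d →
      ∀ X η B : ℝ, 4 * ((d : ℝ) + 2) ^ 2 ≤ X →
      Real.exp (-Real.log X ^ (1 / 3 : ℝ)) ≤ η → η ≤ 1 → 1 ≤ B → B ≤ X ^ 3 →
      ∑ R ∈ (idealsLE ⌊B⌋₊).filter (fun R => 2 ≤ Ideal.absNorm R ∧ Squarefree (Ideal.absNorm R)),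
          |(classCountA X η d a b R : ℝ) -
              (if Nat.Coprime d (Ideal.absNorm R) then
                6 * η ^ 2 * X ^ 2 / Real.pi ^ 2 * zetaTwoCorrection d / (d : ℝ) ^ 2 * rho₂ R /
                  Ideal.absNorm R else 0)| ≤
        C * (B + X * Real.sqrt B + X ^ (3 / 2 : ℝ)) * Real.log X ^ (k + 1) := by
  classical
  obtain ⟨c, C, -, -, hC⟩ := class_typeI_A 1 one_pos
  set k : ℕ := ⌈max c 0⌉₊ with hk
  refine ⟨k, 14 * 5 ^ k * max C 0, by positivity,
    fun d a b hd ha hb hadm X η B hX hηlo hη1 hB1 hBX => ?_⟩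
  set 𝓡 := (idealsLE ⌊B⌋₊).filter (fun R => 2 ≤ Ideal.absNorm R ∧ Squarefree (Ideal.absNorm R))
    with h𝓡
  set J : ℕ := ⌊Real.log (B + 1) / Real.log 2⌋₊ with hJ
  have hd1 : (1 : ℝ) ≤ d := by exact_mod_cast hd
  have hX3 : 3 ≤ X := by nlinarith
  have hX2 : 2 ≤ X := by linarith
  have hX0 : 0 < X := by linarith
  have hX1 : 1 ≤ X := by linarith
  have hηpos : 0 < η := (Real.exp_pos _).trans_le hηlo
  have hl2 : 0 < Real.log 2 := Real.log_pos one_lt_two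
  have hlogX1 : 1 ≤ Real.log X := by
    rw [← Real.log_exp 1]
    refine Real.log_le_log (Real.exp_pos 1) ?_
    have := Real.exp_one_lt_d9
    linarith
  have hlogX0 : 0 < Real.log X := by linarith
  have hB0 : 0 < B := by linarith
  set E : Ideal (𝓞 K) → ℝ := fun R => |(classCountA X η d a b R : ℝ) -
      (if Nat.Coprime d (Ideal.absNorm R) then
        6 * η ^ 2 * X ^ 2 / Real.pi ^ 2 * zetaTwoCorrection d / (d : ℝ) ^ 2 * rho₂ R /
          Ideal.absNorm R else 0)| with hE
  have hE0 : ∀ R, 0 ≤ E R := fun R => abs_nonneg _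
  -- every `R` lies in a block `j ≤ J`
  have hmaps : ∀ R ∈ 𝓡, dyadIdx (Ideal.absNorm R) ∈ range (J + 1) := by
    intro R hR
    rw [h𝓡, mem_filter, mem_idealsLE] at hR
    obtain ⟨hRB, h2, -⟩ := hR
    rw [mem_range, Nat.lt_succ_iff, hJ]
    refine Nat.le_floor (dyadIdx_le_log h2 ?_)
    have : (Ideal.absNorm R : ℝ) ≤ ⌊B⌋₊ := by exact_mod_cast hRB
    linarith [Nat.floor_le hB0.le]
  rw [← sum_fiberwise_of_maps_to hmaps]
  -- the bound for one block
  have h2J : (2 : ℝ) ^ J ≤ B + 1 := two_pow_floor_log_le (by linarith)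
  have hblock : ∀ j ∈ range (J + 1),
      ∑ R ∈ 𝓡.filter (fun R => dyadIdx (Ideal.absNorm R) = j), E R ≤
        max C 0 * (2 * (B + X * Real.sqrt B + X ^ (3 / 2 : ℝ))) * (5 * Real.log X) ^ k := by
    intro j hj
    rw [mem_range, Nat.lt_succ_iff] at hj
    set Q' : ℝ := (2 : ℝ) ^ j with hQ'
    have hQ'1 : 1 ≤ Q' := one_le_pow₀ one_le_two
    have hQ'B : Q' ≤ B + 1 := (pow_le_pow_right₀ one_le_two hj).trans h2J
    have h := hC d a b hd ha hb hadm X η Q' hX hηpos hη1 hQ'1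
    have hsub : 𝓡.filter (fun R => dyadIdx (Ideal.absNorm R) = j) ⊆
        (idealsLE ⌊2 * Q'⌋₊).filter (fun R => Q' < (Ideal.absNorm R : ℝ) ∧
          (Ideal.absNorm R : ℝ) ≤ 2 * Q' ∧ Squarefree (Ideal.absNorm R)) := by
      intro R hR
      rw [mem_filter, h𝓡, mem_filter, mem_idealsLE] at hR
      obtain ⟨⟨-, h2, hsq⟩, hjR⟩ := hR
      have hlt := pow_dyadIdx_lt h2
      have hle := le_pow_dyadIdx_succ (Ideal.absNorm R)
      rw [hjR] at hlt hle
      have hfloor : ⌊2 * Q'⌋₊ = 2 ^ (j + 1) := by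
        rw [hQ', show (2 : ℝ) * 2 ^ j = ((2 ^ (j + 1) : ℕ) : ℝ) by push_cast; ring, Nat.floor_natCast]
      rw [mem_filter, mem_idealsLE, hfloor]
      refine ⟨hle, ?_, ?_, hsq⟩
      · rw [hQ']; exact_mod_cast hlt
      · have : ((Ideal.absNorm R : ℕ) : ℝ) ≤ ((2 ^ (j + 1) : ℕ) : ℝ) := by exact_mod_cast hle
        rw [hQ']
        push_cast at this
        rw [pow_succ] at this
        linarith
    have hpt : ∀ R ∈ 𝓡.filter (fun R => dyadIdx (Ideal.absNorm R) = j), E R ≤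
        (idealDivisorCount R : ℝ) ^ 1 * E R := by
      intro R hR
      rw [mem_filter, h𝓡, mem_filter] at hR
      have hR0 : R ≠ ⊥ := fun h0 => by
        have := hR.1.2.1; rw [h0, Ideal.absNorm_bot] at this; omega
      have hτ : (1 : ℝ) ≤ (idealDivisorCount R : ℝ) ^ 1 := by
        rw [pow_one]; exact_mod_cast one_le_idealDivisorCount hR0
      exact le_mul_of_one_le_left (hE0 R) hτ
    have hnn : ∀ R ∈ (idealsLE ⌊2 * Q'⌋₊).filter (fun R => Q' < (Ideal.absNorm R : ℝ) ∧
          (Ideal.absNorm R : ℝ) ≤ 2 * Q' ∧ Squarefree (Ideal.absNorm R)),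
        0 ≤ (idealDivisorCount R : ℝ) ^ 1 * E R :=
      fun R _ => mul_nonneg (by positivity) (hE0 R)
    -- the logarithm: `log(Q'X)^c ≤ (5 log X)^k`
    have hQX1 : 1 ≤ Real.log (Q' * X) := by
      calc (1 : ℝ) ≤ Real.log X := hlogX1
        _ ≤ Real.log (Q' * X) := Real.log_le_log hX0 (le_mul_of_one_le_left hX0.le hQ'1)
    have hlogQX : Real.log (Q' * X) ≤ 5 * Real.log X := by
      have hQ'X : Q' * X ≤ X ^ 5 := by
        have hB2 : B + 1 ≤ 2 * X ^ 3 := by nlinarith [one_le_pow₀ (n := 3) hX1]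
        calc Q' * X ≤ (2 * X ^ 3) * X := by gcongr; linarith
          _ = 2 * X ^ 4 := by ring
          _ ≤ X * X ^ 4 := by gcongr
          _ = X ^ 5 := by ring
      calc Real.log (Q' * X) ≤ Real.log (X ^ 5) := Real.log_le_log (by positivity) hQ'X
        _ = 5 * Real.log X := by rw [Real.log_pow]; push_cast; ring
    have hck : c ≤ (k : ℝ) := (le_max_left c 0).trans (Nat.le_ceil _)
    have hlogpow : Real.log (Q' * X) ^ c ≤ (5 * Real.log X) ^ k := by
      calc Real.log (Q' * X) ^ c ≤ Real.log (Q' * X) ^ (k : ℝ) :=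
            Real.rpow_le_rpow_of_exponent_le hQX1 hck
        _ = Real.log (Q' * X) ^ k := Real.rpow_natCast _ _
        _ ≤ (5 * Real.log X) ^ k := pow_le_pow_left₀ (by linarith) hlogQX k
    have hgeom : Q' + X * Real.sqrt Q' + X ^ (3 / 2 : ℝ) ≤ 2 * (B + X * Real.sqrt B + X ^ (3 / 2 : ℝ)) := by
      have hs : Real.sqrt Q' ≤ 2 * Real.sqrt B := by
        calc Real.sqrt Q' ≤ Real.sqrt (4 * B) := Real.sqrt_le_sqrt (by linarith)
          _ = 2 * Real.sqrt B := by
              rw [Real.sqrt_mul (by norm_num), show (4 : ℝ) = 2 ^ 2 by norm_num,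
                Real.sqrt_sq (by norm_num)]
      have hX32 : 0 ≤ X ^ (3 / 2 : ℝ) := by positivity
      nlinarith [mul_le_mul_of_nonneg_left hs hX0.le, Real.sqrt_nonneg B]
    calc ∑ R ∈ 𝓡.filter (fun R => dyadIdx (Ideal.absNorm R) = j), E R
        ≤ ∑ R ∈ 𝓡.filter (fun R => dyadIdx (Ideal.absNorm R) = j), (idealDivisorCount R : ℝ) ^ 1 * E R :=
          sum_le_sum hpt
      _ ≤ ∑ R ∈ (idealsLE ⌊2 * Q'⌋₊).filter (fun R => Q' < (Ideal.absNorm R : ℝ) ∧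
            (Ideal.absNorm R : ℝ) ≤ 2 * Q' ∧ Squarefree (Ideal.absNorm R)),
            (idealDivisorCount R : ℝ) ^ 1 * E R :=
          sum_le_sum_of_subset_of_nonneg hsub fun R hR _ => hnn R hR
      _ ≤ C * (Q' + X * Real.sqrt Q' + X ^ (3 / 2 : ℝ)) * Real.log (Q' * X) ^ c := h
      _ ≤ max C 0 * (Q' + X * Real.sqrt Q' + X ^ (3 / 2 : ℝ)) * Real.log (Q' * X) ^ c :=
          mul_le_mul_of_nonneg_right (mul_le_mul_of_nonneg_right (le_max_left _ _) (by positivity))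
            (Real.rpow_nonneg (by linarith) _)
      _ ≤ max C 0 * (2 * (B + X * Real.sqrt B + X ^ (3 / 2 : ℝ))) * (5 * Real.log X) ^ k := by
          gcongr
  -- the number of blocks
  have hJle : ((J + 1 : ℕ) : ℝ) ≤ 7 * Real.log X := by
    have h1 : (J : ℝ) ≤ Real.log (B + 1) / Real.log 2 :=
      Nat.floor_le (div_nonneg (Real.log_nonneg (by linarith)) hl2.le)
    have h2 : Real.log (B + 1) ≤ 4 * Real.log X := by
      have hB2 : B + 1 ≤ X ^ 4 := by nlinarith [one_le_pow₀ (n := 3) hX1]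
      calc Real.log (B + 1) ≤ Real.log (X ^ 4) := Real.log_le_log (by linarith) hB2
        _ = 4 * Real.log X := by rw [Real.log_pow]; push_cast; ring
    have h3 : Real.log (B + 1) / Real.log 2 ≤ 6 * Real.log X := by
      rw [div_le_iff₀ hl2]
      have h69 := Real.log_two_gt_d9
      have : 0.6931471803 * (6 * Real.log X) ≤ Real.log 2 * (6 * Real.log X) :=
        mul_le_mul_of_nonneg_right h69.le (by positivity)
      nlinarith
    push_cast
    linarith
  calc ∑ j ∈ range (J + 1), ∑ R ∈ 𝓡.filter (fun R => dyadIdx (Ideal.absNorm R) = j), E R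
      ≤ ∑ j ∈ range (J + 1),
          max C 0 * (2 * (B + X * Real.sqrt B + X ^ (3 / 2 : ℝ))) * (5 * Real.log X) ^ k :=
        sum_le_sum hblock
    _ = ((J + 1 : ℕ) : ℝ) *
          (max C 0 * (2 * (B + X * Real.sqrt B + X ^ (3 / 2 : ℝ))) * (5 * Real.log X) ^ k) := by
        rw [sum_const, card_range, nsmul_eq_mul]
    _ ≤ (7 * Real.log X) *
          (max C 0 * (2 * (B + X * Real.sqrt B + X ^ (3 / 2 : ℝ))) * (5 * Real.log X) ^ k) :=
        mul_le_mul_of_nonneg_right hJle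
          (mul_nonneg (mul_nonneg (le_max_right C 0) (by positivity)) (pow_nonneg (by linarith) k))
    _ = 14 * 5 ^ k * max C 0 * (B + X * Real.sqrt B + X ^ (3 / 2 : ℝ)) * Real.log X ^ (k + 1) := by
        rw [mul_pow, pow_succ]; ring

open scoped Classical in
/-- **S4a PROVED — class Type I summed over all square-free moduli up to `B`** (the class twin of
`exists_typeI_squarefree_sum_le`): `class_typeI_dyadic` for `N(D) ≥ 2` plus the `D = (1)` term
`exists_abs_classCountA_top_sub_le` (`ρ₂(1) = 1`, `(1, d) = 1`). [cite: HeathBrownMoroz2004, Lemma 2.4 (2.29)]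
[cite: HeathBrownActa2001, Lemma 3.2 and §10 p. 62] -/
theorem classTypeISqfreeSum_holds : ClassTypeISqfreeSum := by
  classical
  intro d a b hd ha hb hadm
  obtain ⟨k, C₂, hC₂, h₂⟩ := class_typeI_dyadic
  obtain ⟨C₁, hC₁, h₁⟩ := exists_abs_classCountA_top_sub_le (a := a) (b := b) hd hadm
  refine ⟨k, max C₁ C₂, le_max_of_le_left hC₁.le, fun X η B hX hηlo hη1 hB1 hBX => ?_⟩
  have hη0 : 0 ≤ η := le_trans (Real.exp_pos _).le hηlo
  have hd1 : (1 : ℝ) ≤ d := by exact_mod_cast hd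
  have hX2 : 2 ≤ X := by nlinarith
  set S := (idealsLE ⌊B⌋₊).filter (fun D => Squarefree (Ideal.absNorm D)) with hS
  set f : Ideal (𝓞 K) → ℝ := fun D => |(classCountA X η d a b D : ℝ) -
      (if Nat.Coprime d (Ideal.absNorm D) then
        6 * η ^ 2 * X ^ 2 / Real.pi ^ 2 * zetaTwoCorrection d / (d : ℝ) ^ 2 * rho₂ D /
          Ideal.absNorm D else 0)| with hf
  rw [← Finset.sum_filter_add_sum_filter_not S (fun D => 2 ≤ Ideal.absNorm D)]
  -- the part `N(D) ≥ 2`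
  have hbig : ∑ D ∈ S.filter (fun D => 2 ≤ Ideal.absNorm D), f D ≤
      C₂ * (B + X * Real.sqrt B + X ^ (3 / 2 : ℝ)) * Real.log X ^ (k + 1) := by
    have hset : S.filter (fun D => 2 ≤ Ideal.absNorm D) =
        (idealsLE ⌊B⌋₊).filter (fun R => 2 ≤ Ideal.absNorm R ∧ Squarefree (Ideal.absNorm R)) := by
      rw [hS, Finset.filter_filter]
      exact Finset.filter_congr fun D _ => and_comm
    rw [hset]
    exact h₂ d a b hd ha hb hadm X η B hX hηlo hη1 hB1 hBX
  -- the part `N(D) < 2`, i.e. `D = (1)`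
  have hρ : rho₂ (⊤ : Ideal (𝓞 K)) = 1 := by
    rw [rho₂_eq_of_squarefree (by rw [Ideal.absNorm_top]; exact squarefree_one), Ideal.absNorm_top,
      Nat.primeFactors_one, prod_empty]
  have hsmall : ∑ D ∈ S.filter (fun D => ¬2 ≤ Ideal.absNorm D), f D ≤ C₁ * X * (1 + Real.log X) := by
    have hsub : S.filter (fun D => ¬2 ≤ Ideal.absNorm D) ⊆ {⊤} := by
      intro D hD
      rw [mem_filter, hS, mem_filter] at hD
      rw [Finset.mem_singleton]
      have h0 : Ideal.absNorm D ≠ 0 := Squarefree.ne_zero hD.1.2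
      have h1 : Ideal.absNorm D = 1 := by omega
      exact Ideal.absNorm_eq_one_iff.mp h1
    calc ∑ D ∈ S.filter (fun D => ¬2 ≤ Ideal.absNorm D), f D ≤ ∑ D ∈ ({⊤} : Finset (Ideal (𝓞 K))), f D :=
          Finset.sum_le_sum_of_subset_of_nonneg hsub fun D _ _ => abs_nonneg _
      _ = |(classCountA X η d a b ⊤ : ℝ) -
            6 * η ^ 2 * X ^ 2 / Real.pi ^ 2 * zetaTwoCorrection d / (d : ℝ) ^ 2| := by
          rw [Finset.sum_singleton, hf]
          simp only
          rw [Ideal.absNorm_top, if_pos (Nat.coprime_one_right _), hρ, Nat.cast_one, mul_one, div_one]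
      _ ≤ C₁ * X * (1 + Real.log X) := h₁ X η hX2 hη0 hη1
  have hlog : 0 ≤ Real.log X := Real.log_nonneg (by linarith)
  have hT1 : 0 ≤ X * (1 + Real.log X) := by nlinarith
  have hT2 : 0 ≤ (B + X * Real.sqrt B + X ^ (3 / 2 : ℝ)) * Real.log X ^ (k + 1) := by positivity
  calc ∑ D ∈ S.filter (fun D => 2 ≤ Ideal.absNorm D), f D +
        ∑ D ∈ S.filter (fun D => ¬2 ≤ Ideal.absNorm D), f D
      ≤ C₂ * (B + X * Real.sqrt B + X ^ (3 / 2 : ℝ)) * Real.log X ^ (k + 1) + C₁ * X * (1 + Real.log X) :=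
        add_le_add hbig hsmall
    _ ≤ max C₁ C₂ * ((B + X * Real.sqrt B + X ^ (3 / 2 : ℝ)) * Real.log X ^ (k + 1)) +
        max C₁ C₂ * (X * (1 + Real.log X)) := by
        rw [mul_assoc, mul_assoc]
        exact add_le_add (mul_le_mul_of_nonneg_right (le_max_right _ _) hT2)
          (mul_le_mul_of_nonneg_right (le_max_left _ _) hT1)
    _ = max C₁ C₂ * (X * (1 + Real.log X) + (B + X * Real.sqrt B + X ^ (3 / 2 : ℝ)) * Real.log X ^ (k + 1)) := by
        ring

/-! ### S4b, EQ39 and the class Lemma 3.9 `h39` — all PROVED (v5) -/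

/-- **S4b CLOSED, 0-ary form (v5):** the class display (10.4) `U_e(𝒜_cl) = (w/d²)σ₀η²X²Σ₃ + O(M⁻¹η^{5/2}X²(log X)^c)` from the
landed closer applied to the PROVED S4a `classTypeISqfreeSum_holds` and the CLOSED S3 `sigmaOneCoprime_holds`.
[cite: HeathBrownActa2001, §10 (10.4)] [cite: HeathBrownMoroz2004, Lemma 4.1] -/
theorem classDisplay104_holds : ClassDisplay104 :=
  classDisplay104_of_typeISqfreeSum_of_sigmaOneCoprime classTypeISqfreeSum_holds sigmaOneCoprime_holds

/-! ### Falsifier certificates (PROVED): the normalisations of S4b, S3 and S4p are the right ones -/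

/-- **Cheapest falsifier of S4b's constant, RUN: the class main-term constant IS `(w(d)/d²)σ₀`.**
`X_cl · (π²/6)σ₀·coprimeClassWeight d = (w(d)/d²)·σ₀η²X²` with `X_cl = (6η²X²/π²)(ζ(2)/ζ_d(2))d⁻²`
(`coprimeClassWeight_mul_zetaTwoCorrection`). [cite: HeathBrownMoroz2004, §3 (3.1)] -/
theorem classDisplay104_mainConst (d : ℕ) (σ₀ η X S : ℝ) :
    6 * η ^ 2 * X ^ 2 / Real.pi ^ 2 * zetaTwoCorrection d / (d : ℝ) ^ 2 *
        (Real.pi ^ 2 / 6 * σ₀ * coprimeClassWeight d) * S =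
      classWeight d / (d : ℝ) ^ 2 * (σ₀ * η ^ 2 * X ^ 2 * S) := by
  rw [← coprimeClassWeight_mul_zetaTwoCorrection]
  have hπ : Real.pi ^ 2 ≠ 0 := pow_ne_zero 2 Real.pi_ne_zero
  rw [div_eq_mul_inv _ (Real.pi ^ 2)]
  have : Real.pi ^ 2 * (Real.pi ^ 2)⁻¹ = 1 := mul_inv_cancel₀ hπ
  calc 6 * η ^ 2 * X ^ 2 * (Real.pi ^ 2)⁻¹ * zetaTwoCorrection d / (d : ℝ) ^ 2 *
          (Real.pi ^ 2 / 6 * σ₀ * coprimeClassWeight d) * S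
        = (Real.pi ^ 2 * (Real.pi ^ 2)⁻¹) * (coprimeClassWeight d * zetaTwoCorrection d / (d : ℝ) ^ 2 *
            (σ₀ * η ^ 2 * X ^ 2 * S)) := by ring
    _ = _ := by rw [this, one_mul]

open scoped Classical in
/-- **Cheapest falsifier of S3's normalisation, RUN: at `d = 1` the statement IS the tree's `Σ₁` theorem**
(`coprimeClassWeight 1 = 1`, the coprimality condition is vacuous). [cite: HeathBrownActa2001, §10 p. 63] -/
theorem classSigmaOneCoprime_one (σ₀ : ℝ) (hσ : Tendsto singularProductPartial atTop (𝓝 σ₀)) :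
    ∃ c : ℝ, 0 < c ∧ ∃ C : ℝ, 0 < C ∧ ∀ x : ℝ, 1 ≤ x →
      |(∑ J ∈ (idealsLE ⌊x⌋₊).filter
          (fun J => Squarefree (Ideal.absNorm J) ∧ Nat.Coprime 1 (Ideal.absNorm J)),
          idealMoebius J * Real.log (x / Ideal.absNorm J) * (rho₂ J / Ideal.absNorm J)) -
        Real.pi ^ 2 / 6 * σ₀ * coprimeClassWeight 1| ≤ C * Real.exp (-c * Real.sqrt (Real.log x)) := by
  obtain ⟨c, hc, C, hC, h⟩ := HeathBrown2001_sigmaOne_bound hσ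
  refine ⟨c, hc, C, hC, fun x hx => ?_⟩
  have hw : coprimeClassWeight 1 = 1 := by
    rw [coprimeClassWeight, Nat.primeFactors_one, prod_empty]
  have hfilter : (idealsLE ⌊x⌋₊).filter
      (fun J => Squarefree (Ideal.absNorm J) ∧ Nat.Coprime 1 (Ideal.absNorm J)) =
      (idealsLE ⌊x⌋₊).filter (fun J => Squarefree (Ideal.absNorm J)) :=
    filter_congr fun J _ => by simp
  rw [hw, mul_one, hfilter]
  exact h x hx

open scoped Classical in
/-- **Cheapest falsifier of S4p's shape, RUN: at `d = 1` the statement IS the tree's `abs_sum_pairs_countA_sub_le`**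
(`classPairs_one`: `#𝒜_{cl,D} = #𝒜^(K)_D`; `zetaTwoCorrection 1 = 1`, so `X_cl = X_𝒜 = sizeA X η`; the coprimality
conditions `(·, 1) = 1` are vacuous). [cite: HeathBrownActa2001, §10 p. 62] -/
theorem classPairsTypeI_one (a b : ℕ) {X η z L Rmax A B : ℝ} (hX : 0 ≤ X) (hz : L ≤ z) (hRmax : 0 ≤ Rmax)
    (𝓡 : Finset (Ideal (𝓞 K))) (α β : Ideal (𝓞 K) → ℝ)
    (hα : ∀ R ∈ 𝓡, α R ≠ 0 → Squarefree (Ideal.absNorm R) ∧ IsRough z R ∧ (Ideal.absNorm R : ℝ) ≤ Rmax)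
    (hαA : ∀ R ∈ 𝓡, |α R| ≤ A) (hβ : ∀ J, β J ≠ 0 → Squarefree J)
    (hβB : ∀ J ∈ (idealsLE ⌊L⌋₊).filter (fun J => (Ideal.absNorm J : ℝ) < L), |β J| ≤ B)
    (hA : 0 ≤ A) (hB : 0 ≤ B) :
    |(∑ R ∈ 𝓡, ∑ J ∈ (idealsLE ⌊L⌋₊).filter (fun J => (Ideal.absNorm J : ℝ) < L),
        α R * β J * (classCountA X η 1 a b (R * J) : ℝ)) -
      6 * η ^ 2 * X ^ 2 / Real.pi ^ 2 * zetaTwoCorrection 1 / ((1 : ℕ) : ℝ) ^ 2 *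
        (∑ R ∈ 𝓡.filter (fun R => Nat.Coprime 1 (Ideal.absNorm R)), α R * (rho₂ R / Ideal.absNorm R)) *
        ∑ J ∈ ((idealsLE ⌊L⌋₊).filter (fun J => (Ideal.absNorm J : ℝ) < L)).filter
          (fun J => Squarefree (Ideal.absNorm J) ∧ Nat.Coprime 1 (Ideal.absNorm J)),
          β J * (rho₂ J / Ideal.absNorm J)| ≤
      A * B * ∑ D ∈ (idealsLE ⌊Rmax * L⌋₊).filter (fun D => Squarefree (Ideal.absNorm D)),
        |(classCountA X η 1 a b D : ℝ) -
          (if Nat.Coprime 1 (Ideal.absNorm D) then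
            6 * η ^ 2 * X ^ 2 / Real.pi ^ 2 * zetaTwoCorrection 1 / ((1 : ℕ) : ℝ) ^ 2 * rho₂ D /
              Ideal.absNorm D else 0)| := by
  have hcount : ∀ D, classCountA X η 1 a b D = countA X η D := fun D => by
    rw [classCountA, classAPairs, classPairs_one, countA, APairs]
  have hsize : 6 * η ^ 2 * X ^ 2 / Real.pi ^ 2 * zetaTwoCorrection 1 / ((1 : ℕ) : ℝ) ^ 2 = sizeA X η := by
    rw [zetaTwoCorrection_one, sizeA, Nat.cast_one, one_pow, div_one, mul_one]
  have hR : 𝓡.filter (fun R => Nat.Coprime 1 (Ideal.absNorm R)) = 𝓡 :=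
    filter_true_of_mem fun R _ => Nat.coprime_one_left _
  have hJ : ((idealsLE ⌊L⌋₊).filter (fun J => (Ideal.absNorm J : ℝ) < L)).filter
      (fun J => Squarefree (Ideal.absNorm J) ∧ Nat.Coprime 1 (Ideal.absNorm J)) =
      ((idealsLE ⌊L⌋₊).filter (fun J => (Ideal.absNorm J : ℝ) < L)).filter
        (fun J => Squarefree (Ideal.absNorm J)) :=
    filter_congr fun J _ => by simp
  have hrhs : ∑ D ∈ (idealsLE ⌊Rmax * L⌋₊).filter (fun D => Squarefree (Ideal.absNorm D)),
        |(classCountA X η 1 a b D : ℝ) - (if Nat.Coprime 1 (Ideal.absNorm D) then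
            6 * η ^ 2 * X ^ 2 / Real.pi ^ 2 * zetaTwoCorrection 1 / ((1 : ℕ) : ℝ) ^ 2 * rho₂ D /
              Ideal.absNorm D else 0)| =
      ∑ D ∈ (idealsLE ⌊Rmax * L⌋₊).filter (fun D => Squarefree (Ideal.absNorm D)),
        |(countA X η D : ℝ) - sizeA X η * rho₂ D / Ideal.absNorm D| :=
    sum_congr rfl fun D _ => by rw [if_pos (Nat.coprime_one_left _), hsize, hcount]
  have hlhs : (∑ R ∈ 𝓡, ∑ J ∈ (idealsLE ⌊L⌋₊).filter (fun J => (Ideal.absNorm J : ℝ) < L),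
        α R * β J * (classCountA X η 1 a b (R * J) : ℝ)) =
      ∑ R ∈ 𝓡, ∑ J ∈ (idealsLE ⌊L⌋₊).filter (fun J => (Ideal.absNorm J : ℝ) < L),
        α R * β J * (countA X η (R * J) : ℝ) :=
    sum_congr rfl fun R _ => sum_congr rfl fun J _ => by rw [hcount]
  rw [hrhs, hlhs, hR, hJ, hsize]
  exact abs_sum_pairs_countA_sub_le hX hz hRmax 𝓡 α β hα hαA hβ hβB hA hB

/-! ### Glue (PROVED): the class lemmas `h35`, `h39` from the differenced statements and the parent lemmas -/

/-- The triangle inequality through the scaled parent: `|A − wκB| ≤ |A − wP| + w|P − κB|` for `w ≥ 0`.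
[folklore] -/
theorem abs_sub_le_of_mid {A P B w κ : ℝ} (hw : 0 ≤ w) :
    |A - w * κ * B| ≤ |A - w * P| + w * |P - κ * B| := by
  have h := abs_sub_le A (w * P) (w * κ * B)
  have e : w * P - w * κ * B = w * (P - κ * B) := by ring
  rw [e, abs_mul, abs_of_nonneg hw] at h
  exact h

/-- `|A − wB| ≤ |A − wP| + w|P − B|` for `w ≥ 0` (class (10.4) vs the scaled parent (10.4)). [folklore] -/
theorem abs_sub_le_of_mid₁ {A P B w : ℝ} (hw : 0 ≤ w) :
    |A - w * B| ≤ |A - w * P| + w * |P - B| := by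
  have h := abs_sub_le A (w * P) (w * B)
  have e : w * P - w * B = w * (P - B) := by ring
  rw [e, abs_mul, abs_of_nonneg hw] at h
  exact h

/-- `|A − wP| ≤ |A − wκB| + w|P − κB|` for `w ≥ 0` (EQ35 from the direct class Lemma 3.5 and the parent's).
[folklore] -/
theorem abs_sub_le_of_mid₂ {A P B w κ : ℝ} (hw : 0 ≤ w) :
    |A - w * P| ≤ |A - w * κ * B| + w * |P - κ * B| := by
  have h := abs_sub_le A (w * κ * B) (w * P)
  have e : w * κ * B - w * P = w * (κ * B - P) := by ring
  rw [e, abs_mul, abs_of_nonneg hw, abs_sub_comm (κ * B) P] at h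
  exact h

/-- Merging two power-of-log bounds: `C·F·L^c ≤ |C|·F·L^{c'}` for `F ≥ 0`, `L ≥ 1`, `c ≤ c'`
(`F = M⁻¹η^{5/2}X²` written as three factors). [folklore] -/
theorem const_rpow_mono {C M E X2 L c c' : ℝ} (hM : 0 ≤ M) (hE : 0 ≤ E) (hX : 0 ≤ X2) (hL : 1 ≤ L)
    (hc : c ≤ c') : C * M * E * X2 * L ^ c ≤ |C| * M * E * X2 * L ^ c' := by
  have h1 : 0 ≤ L ^ c := Real.rpow_nonneg (by linarith) _
  have h2 : L ^ c ≤ L ^ c' := Real.rpow_le_rpow_of_exponent_le hL hc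
  have hF : 0 ≤ M * E * X2 := mul_nonneg (mul_nonneg hM hE) hX
  have e1 : C * M * E * X2 * L ^ c = C * (M * E * X2) * L ^ c := by ring
  have e2 : |C| * M * E * X2 * L ^ c' = |C| * (M * E * X2) * L ^ c' := by ring
  rw [e1, e2]
  calc C * (M * E * X2) * L ^ c ≤ |C| * (M * E * X2) * L ^ c :=
        mul_le_mul_of_nonneg_right (mul_le_mul_of_nonneg_right (le_abs_self C) hF) h1
    _ ≤ |C| * (M * E * X2) * L ^ c' := mul_le_mul_of_nonneg_left h2 (mul_nonneg (abs_nonneg C) hF)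

/-- `w(d)/d² ≥ 0`. [cite: HeathBrownMoroz2004, (3.1)] -/
theorem classWeight_div_sq_nonneg (d : ℕ) : 0 ≤ classWeight d / (d : ℝ) ^ 2 :=
  div_nonneg (classWeight_pos d).le (pow_nonneg (Nat.cast_nonneg d) 2)

/-- **`h35` from EQ35 and the parent's Lemma 3.5 (tree: `HeathBrown2001_lemma_3_5_holds`).**
`T⁽ⁿ⁾(𝒜_cl) − κ_d T⁽ⁿ⁾(ℬ) = [T⁽ⁿ⁾(𝒜_cl) − (w/d²)T⁽ⁿ⁾(𝒜)] + (w/d²)[T⁽ⁿ⁾(𝒜) − κT⁽ⁿ⁾(ℬ)]`, `κ_d = (w/d²)κ`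
(`classKappa_def`); constants `C₁ + (w/d²)C₂`, `X₀ = max`. [cite: HeathBrownMoroz2004, Lemma 3.1]
[cite: HeathBrownActa2001, Lemma 3.5] -/
theorem h35_of_flDifferencing (hFL : ClassFLDifferencing) :
    ∀ d a b : ℕ, 0 < d → a < d → b < d → Nat.Coprime (a ^ 3 + 2 * b ^ 3) d →
      ∀ σ₀ : ℝ, Tendsto singularProductPartial atTop (𝓝 σ₀) → ∀ ϖ : ℝ, 0 < ϖ → ϖ < 1 / 5 →
        ∃ C X₀ : ℝ, ∀ X η : ℝ, X₀ ≤ X → Real.exp (-Real.log X ^ (1 / 3 : ℝ)) ≤ η → η ≤ 1 →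
          ∑ n ∈ range (chainBound (hbTau ϖ X) + 1),
              |(Tpiece (classPairs X η d a b) pairIdeal X (hbTau ϖ X) n : ℝ) -
                  classKappa σ₀ X η d * Tpiece (normWindow X η) (fun J => J) X (hbTau ϖ X) n| ≤
            C * hbTau ϖ X * η ^ 2 * X ^ 2 / Real.log X := by
  intro d a b hd ha hb hadm σ₀ hσ ϖ hϖ0 hϖ5
  obtain ⟨C₁, X₁, h₁⟩ := hFL d a b hd ha hb hadm ϖ hϖ0 hϖ5
  obtain ⟨C₂, X₂, h₂⟩ := HeathBrown2001_lemma_3_5_holds σ₀ hσ ϖ hϖ0 hϖ5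
  have hw := classWeight_div_sq_nonneg d
  refine ⟨C₁ + classWeight d / (d : ℝ) ^ 2 * C₂, max X₁ X₂, fun X η hX hη hη1 => ?_⟩
  have e₁ := h₁ X η ((le_max_left _ _).trans hX) hη hη1
  have e₂ := h₂ X η ((le_max_right _ _).trans hX) hη hη1
  simp only [classKappa_def]
  refine (sum_le_sum fun n _ => abs_sub_le_of_mid
    (P := (Tpiece (boxPairs X η) pairIdeal X (hbTau ϖ X) n : ℝ)) hw).trans ?_
  rw [sum_add_distrib, ← mul_sum]
  refine (add_le_add e₁ (mul_le_mul_of_nonneg_left e₂ hw)).trans_eq ?_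
  ring

/-- **EQ35 from the direct class Lemma 3.5 and the parent's** (the alternative discharge of S2):
`T⁽ⁿ⁾(𝒜_cl) − (w/d²)T⁽ⁿ⁾(𝒜) = [T⁽ⁿ⁾(𝒜_cl) − κ_dT⁽ⁿ⁾(ℬ)] − (w/d²)[T⁽ⁿ⁾(𝒜) − κT⁽ⁿ⁾(ℬ)]` with `σ₀` supplied by the
tree's `HeathBrown2001_singularProduct_holds`. [cite: HeathBrownMoroz2004, Lemma 3.1] [cite: HeathBrownActa2001, Lemma 3.5] -/
theorem classFLDifferencing_of_h35 (h : ClassH35) : ClassFLDifferencing := by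
  intro d a b hd ha hb hadm ϖ hϖ0 hϖ5
  obtain ⟨σ₀, -, hσ⟩ := HeathBrown2001_singularProduct_holds
  obtain ⟨C₁, X₁, h₁⟩ := h d a b hd ha hb hadm σ₀ hσ ϖ hϖ0 hϖ5
  obtain ⟨C₂, X₂, h₂⟩ := HeathBrown2001_lemma_3_5_holds σ₀ hσ ϖ hϖ0 hϖ5
  have hw := classWeight_div_sq_nonneg d
  refine ⟨C₁ + classWeight d / (d : ℝ) ^ 2 * C₂, max X₁ X₂, fun X η hX hη hη1 => ?_⟩
  have e₁ := h₁ X η ((le_max_left _ _).trans hX) hη hη1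
  have e₂ := h₂ X η ((le_max_right _ _).trans hX) hη hη1
  simp only [classKappa_def] at e₁
  refine (sum_le_sum fun n _ => abs_sub_le_of_mid₂
    (κ := kappa σ₀ X η) (B := (Tpiece (normWindow X η) (fun J => J) X (hbTau ϖ X) n : ℝ)) hw).trans ?_
  rw [sum_add_distrib, ← mul_sum]
  refine (add_le_add e₁ (mul_le_mul_of_nonneg_left e₂ hw)).trans_eq ?_
  ring

/-- **The direct class Lemma 3.5 HOLDS (v3): it is the tree's `class_lemma_3_5`** (p555871,
`Literature.NumberTheory.Sieve.HeathBrownMorozClassLemma35`, the coset port of `HeathBrown2001_lemma_3_5_of` with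
the level input `class_level` and `z = X^τ > d`), statement = `ClassH35` verbatim.
[cite: HeathBrownMoroz2004, Lemma 3.1] [cite: HeathBrownActa2001, Lemma 3.5 and §6] -/
theorem classH35_holds : ClassH35 :=
  fun _d _a _b hd ha hb hadm σ₀ hσ ϖ hϖ0 hϖ5 => class_lemma_3_5 hd ha hb hadm σ₀ hσ ϖ hϖ0 hϖ5

/-- **S2 = EQ35 PROVED (v3)**: the differenced Fundamental-Lemma terms, from the landed class Lemma 3.5 and the
parent's (`classFLDifferencing_of_h35`).  This closes the v2 stub `stub_flDifferencing`.
[cite: HeathBrownMoroz2004, Lemma 3.1] [cite: HeathBrownActa2001, Lemma 3.5] -/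
theorem flDifferencing_holds : ClassFLDifferencing :=
  classFLDifferencing_of_h35 classH35_holds

/-- **EQ39 from the class display (10.4) (S4b) and the parent's display (10.4)** (tree:
`HeathBrown2001_display_10_4`): `Û_e(𝒜_cl) − (w/d²)Û_e(𝒜) = [Û_e(𝒜_cl) − (w/d²)σ₀η²X²Σ₃] − (w/d²)[Û_e(𝒜) − σ₀η²X²Σ₃]`,
`σ₀` from `HeathBrown2001_singularProduct_holds`; exponents merged to `max c₁ c₂` (`log X ≥ 1` for `X ≥ e`),
constants `|C₁| + (w/d²)|C₂|`. [cite: HeathBrownActa2001, §10 (10.4)] [cite: HeathBrownMoroz2004, Lemma 4.1] -/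
theorem classLeadingDifferencing_of_display104 (hD : ClassDisplay104) : ClassLeadingDifferencing := by
  intro d a b hd ha hb hadm ϖ hϖ0 hϖ5
  obtain ⟨σ₀, -, hσ⟩ := HeathBrown2001_singularProduct_holds
  obtain ⟨c₁, C₁, X₁, h₁⟩ := hD d a b hd ha hb hadm σ₀ hσ ϖ hϖ0 hϖ5
  obtain ⟨c₂, C₂, X₂, h₂⟩ := HeathBrown2001_display_10_4 σ₀ hσ ϖ hϖ0 hϖ5
  have hw := classWeight_div_sq_nonneg d
  refine ⟨max c₁ c₂, |C₁| + classWeight d / (d : ℝ) ^ 2 * |C₂|, max (max X₁ X₂) (Real.exp 1), ?_⟩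
  intro X η hX hη hη1 k m hm cR hcR
  have hX1 : X₁ ≤ X := (le_max_left _ _).trans ((le_max_left _ _).trans hX)
  have hX2 : X₂ ≤ X := (le_max_right _ _).trans ((le_max_left _ _).trans hX)
  have hXe : Real.exp 1 ≤ X := (le_max_right _ _).trans hX
  have hlog : 1 ≤ Real.log X := by
    have h := Real.log_le_log (Real.exp_pos 1) hXe
    rwa [Real.log_exp] at h
  have hη0 : 0 ≤ η := (Real.exp_pos _).le.trans hη
  have hM : 0 ≤ (∏ i, (m i : ℝ))⁻¹ := inv_nonneg.2 (prod_nonneg fun i _ => Nat.cast_nonneg _)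
  have hE : 0 ≤ η ^ (5 / 2 : ℝ) := Real.rpow_nonneg hη0 _
  have hX2' : 0 ≤ X ^ 2 := sq_nonneg X
  have e₁ := h₁ X η hX1 hη hη1 k m hm cR hcR
  have e₂ := h₂ X η hX2 hη hη1 k m hm cR hcR
  rw [abs_sub_comm] at e₂
  refine (abs_sub_le_of_mid₁
    (P := σ₀ * η ^ 2 * X ^ 2 * sigma3 X (hbTau ϖ X) m cR) hw).trans ?_
  refine (add_le_add (e₁.trans (const_rpow_mono hM hE hX2' hlog (le_max_left c₁ c₂)))
    (mul_le_mul_of_nonneg_left (e₂.trans (const_rpow_mono hM hE hX2' hlog (le_max_right c₁ c₂)))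
      hw)).trans_eq ?_
  ring

/-- **`h39` from EQ39 and the parent's Lemma 3.9 (tree: `HeathBrown2001_lemma_3_9_holds`).**
`Û_e(𝒜_cl) − κ_d Û(ℬ) = [Û_e(𝒜_cl) − (w/d²)Û_e(𝒜)] + (w/d²)[Û_e(𝒜) − κÛ(ℬ)]`; exponents merged to
`max c₁ c₂` using `log X ≥ 1` (`X₀ ≥ e`), constants `|C₁| + (w/d²)|C₂|`. [cite: HeathBrownMoroz2004, Lemma 4.1]
[cite: HeathBrownActa2001, Lemma 3.9] -/
theorem h39_of_leadingDifferencing (hLD : ClassLeadingDifferencing) :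
    ∀ d a b : ℕ, 0 < d → a < d → b < d → Nat.Coprime (a ^ 3 + 2 * b ^ 3) d →
      ∀ σ₀ : ℝ, Tendsto singularProductPartial atTop (𝓝 σ₀) → ∀ ϖ : ℝ, 0 < ϖ → ϖ < 1 / 5 →
        ∃ c C X₀ : ℝ, ∀ X η : ℝ, X₀ ≤ X → Real.exp (-Real.log X ^ (1 / 3 : ℝ)) ≤ η → η ≤ 1 →
          ∀ (k : ℕ) (m : Fin k → ℕ), CoreAdmissible (hbTau ϖ X) m →
            ∀ cR : Ideal (𝓞 K) → ℝ, CSupport X (hbTau ϖ X) cR →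
              |bilin (classPairs X η d a b) pairIdeal cR (eWeight X (hbTau ϖ X) m) -
                  classKappa σ₀ X η d *
                    bilin (normWindow X η) (fun J => J) cR (dWeight X (hbTau ϖ X) m)| ≤
                C * (∏ i, (m i : ℝ))⁻¹ * η ^ (5 / 2 : ℝ) * X ^ 2 * Real.log X ^ c := by
  intro d a b hd ha hb hadm σ₀ hσ ϖ hϖ0 hϖ5
  obtain ⟨c₁, C₁, X₁, h₁⟩ := hLD d a b hd ha hb hadm ϖ hϖ0 hϖ5
  obtain ⟨c₂, C₂, X₂, h₂⟩ := HeathBrown2001_lemma_3_9_holds σ₀ hσ ϖ hϖ0 hϖ5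
  have hw := classWeight_div_sq_nonneg d
  refine ⟨max c₁ c₂, |C₁| + classWeight d / (d : ℝ) ^ 2 * |C₂|, max (max X₁ X₂) (Real.exp 1), ?_⟩
  intro X η hX hη hη1 k m hm cR hcR
  have hX1 : X₁ ≤ X := (le_max_left _ _).trans ((le_max_left _ _).trans hX)
  have hX2 : X₂ ≤ X := (le_max_right _ _).trans ((le_max_left _ _).trans hX)
  have hXe : Real.exp 1 ≤ X := (le_max_right _ _).trans hX
  have hlog : 1 ≤ Real.log X := by
    have h := Real.log_le_log (Real.exp_pos 1) hXe
    rwa [Real.log_exp] at h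
  have hη0 : 0 ≤ η := (Real.exp_pos _).le.trans hη
  have hM : 0 ≤ (∏ i, (m i : ℝ))⁻¹ := inv_nonneg.2 (prod_nonneg fun i _ => Nat.cast_nonneg _)
  have hE : 0 ≤ η ^ (5 / 2 : ℝ) := Real.rpow_nonneg hη0 _
  have hX2' : 0 ≤ X ^ 2 := sq_nonneg X
  have e₁ := h₁ X η hX1 hη hη1 k m hm cR hcR
  have e₂ := h₂ X η hX2 hη hη1 k m hm cR hcR
  simp only [classKappa_def]
  refine (abs_sub_le_of_mid
    (P := bilin (boxPairs X η) pairIdeal cR (eWeight X (hbTau ϖ X) m)) hw).trans ?_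
  refine (add_le_add (e₁.trans (const_rpow_mono hM hE hX2' hlog (le_max_left c₁ c₂)))
    (mul_le_mul_of_nonneg_left (e₂.trans (const_rpow_mono hM hE hX2' hlog (le_max_right c₁ c₂)))
      hw)).trans_eq ?_
  ring

/-! ### EQ39 and `h39` of the class are THEOREMS (v5): Part A is entirely closed -/

/-- **EQ39 PROVED (v5):** the differenced leading terms `ClassLeadingDifferencing`, from the CLOSED class display (10.4)
and the parent's (10.4). [cite: HeathBrownActa2001, §10 (10.4)] [cite: HeathBrownMoroz2004, Lemma 4.1] -/
theorem classLeadingDifferencing_holds : ClassLeadingDifferencing :=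
  classLeadingDifferencing_of_display104 classDisplay104_holds

/-- **The class Lemma 3.9 `h39` of Heath-Brown–Moroz (Prop. 4.2 (i), leading `e`-parts vs `κ_d·ℬ`) is a THEOREM (v5):**
EQ39 + the parent's PROVED Lemma 3.9 — the second of the three class hypotheses of `heathBrownMorozUniform_of_classLemmas`
is discharged (the first, `h35`, is `h35_of_flDifferencing flDifferencing_holds` since v3).
[cite: HeathBrownMoroz2004, Proposition 4.2] [cite: HeathBrownActa2001, Lemma 3.9] -/
theorem classH39_holds :
    ∀ d a b : ℕ, 0 < d → a < d → b < d → Nat.Coprime (a ^ 3 + 2 * b ^ 3) d →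
      ∀ σ₀ : ℝ, Tendsto singularProductPartial atTop (𝓝 σ₀) → ∀ ϖ : ℝ, 0 < ϖ → ϖ < 1 / 5 →
        ∃ c C X₀ : ℝ, ∀ X η : ℝ, X₀ ≤ X → Real.exp (-Real.log X ^ (1 / 3 : ℝ)) ≤ η → η ≤ 1 →
          ∀ (k : ℕ) (m : Fin k → ℕ), CoreAdmissible (hbTau ϖ X) m →
            ∀ cR : Ideal (𝓞 K) → ℝ, CSupport X (hbTau ϖ X) cR →
              |bilin (classPairs X η d a b) pairIdeal cR (eWeight X (hbTau ϖ X) m) -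
                  classKappa σ₀ X η d *
                    bilin (normWindow X η) (fun J => J) cR (dWeight X (hbTau ϖ X) m)| ≤
                C * (∏ i, (m i : ℝ))⁻¹ * η ^ (5 / 2 : ℝ) * X ^ 2 * Real.log X ^ c :=
  h39_of_leadingDifferencing classLeadingDifferencing_holds

/-- **… and so is the class Lemma 3.5 `h35`** (named here for the record; v3). [cite: HeathBrownMoroz2004, Proposition 4.2] -/
theorem classH35_lemma_holds :
    ∀ d a b : ℕ, 0 < d → a < d → b < d → Nat.Coprime (a ^ 3 + 2 * b ^ 3) d →
      ∀ σ₀ : ℝ, Tendsto singularProductPartial atTop (𝓝 σ₀) → ∀ ϖ : ℝ, 0 < ϖ → ϖ < 1 / 5 →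
        ∃ C X₀ : ℝ, ∀ X η : ℝ, X₀ ≤ X → Real.exp (-Real.log X ^ (1 / 3 : ℝ)) ≤ η → η ≤ 1 →
          ∑ n ∈ range (chainBound (hbTau ϖ X) + 1),
              |(Tpiece (classPairs X η d a b) pairIdeal X (hbTau ϖ X) n : ℝ) -
                  classKappa σ₀ X η d * Tpiece (normWindow X η) (fun J => J) X (hbTau ϖ X) n| ≤
            C * hbTau ϖ X * η ^ 2 * X ^ 2 / Real.log X :=
  h35_of_flDifferencing flDifferencing_holds

/-! ## Part B — the class Type II half = line `unit-split-positivity`, transplanted VERBATIM from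
`Lines/unit_split_positivity.lean` v3 (commit of 2026-08-27T18:31:38Z; that file and `Lines/unit-split-positivity.md` carry the
canonical commentary of this half; stub names and statements unchanged so the ONE registered skeleton keeps every stub of both lines active): signatures, stubs E3–E5, proved
bookkeeping, and the discharge of the sibling's `ClassTypeIIBound` -/

/-- Signature of `stub_classMainError`: passage to generators and Möbius inversion over `gcd(x, y)` for the
CLASS sum `S_V^{cl}` — main term `Σ_{(x,y) ∈ box, x ≡ a₀, y ≡ b₀ (d)} Hprim(x,y)` plus an error with the
d = 1 majorant `E_V ≪ X²(X^τ)^{-1/2}(log X)^e` ((11.2)). -/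
def Sig.stub_classMainError : Prop :=
  ∃ C e : ℝ, 0 < C ∧ 0 ≤ e ∧
    ∀ (X η τ V T : ℝ) (n : ℕ) (m : Fin (n + 1) → ℕ) (c : Ideal (𝓞 K) → ℝ) (d a₀ b₀ : ℕ),
      2 ≤ X → 0 ≤ η → η ≤ 1 → 0 < τ → τ ≤ 1 → 0 < T → CoreAdmissible τ m → CSupport X τ c →
        |bilin (classPairs X η d a₀ b₀) pairIdeal c (gCut X τ m V) -
            ∑ xy ∈ (box X η).filter (fun xy => xy.1 ≡ a₀ [MOD d] ∧ xy.2 ≡ b₀ [MOD d]),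
              Hprim X τ m V T c xy| ≤
          C * X ^ 2 * (X ^ τ) ^ (-(1 / 2 : ℝ)) * Real.log X ^ e

open scoped Classical in
/-- Signature of `stub_classMainCauchy`: the residue split of the class main term over the `d³` residues
`v` of `β̂ (mod d)` followed by Cauchy's inequality of p. 68 (the class indicator, a function of `(α̂, v)`,
is bounded by `1`): `|M_V^{cl}| ≤ (#Abox)^{1/2} Σ_v S(v)^{1/2}`, `S(v)` the dispersion sum twisted by
`[β̂ ≡ v (d)]`. -/
def Sig.stub_classMainCauchy : Prop :=
  ∀ (X η τ V T : ℝ) (k : ℕ) (m : Fin k → ℕ) (c : Ideal (𝓞 K) → ℝ) (d a₀ b₀ : ℕ),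
    0 < X → η ≤ 1 → 0 < T → T ^ 3 = V → CSupport X τ c → 0 < d →
      |∑ xy ∈ (box X η).filter (fun xy => xy.1 ≡ a₀ [MOD d] ∧ xy.2 ≡ b₀ [MOD d]), Hprim X τ m V T c xy| ≤
        Real.sqrt (#(Abox X T)) *
          ∑ v ∈ Finset.Ico (0 : ℤ) d ×ˢ (Finset.Ico (0 : ℤ) d ×ˢ Finset.Ico (0 : ℤ) d),
            Real.sqrt (∑ a ∈ (Abox X T).filter IsPrimitiveVec,
              (∑ b ∈ Bbox T, if Wab X η a b then
                  (if DvdVec (d : ℤ) (b - v) then (1 : ℝ) else 0) * Fb X τ m V T b else 0) ^ 2)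

open scoped Classical in
/-- Signature of `stub_twistedSsum` (LOAD-BEARING): the bound for the twisted dispersion sum
`S_w = Σ_{α̂ prim} |Σ_β̂ w(β̂) F_β W(α̂β̂)|²`, `w` `d`-periodic with `|w| ≤ 1`, under the parameter
inequalities of the tree's `Ssum_le_of_params` and (3.14) up to `d·Q₁` — the same four-term bound
`S ≪_d XV (Y⁻¹ + Y⁶⁰X^{-τ/2} + Y¹⁶Q₁^{-1/4} + Y¹⁶Q₁⁴e^{-c₁√log L}) (log X)^{c₀}` (Lemma 12.2 + §13). -/
def Sig.stub_twistedSsum : Prop :=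
  ∃ c₀ : ℝ, 0 ≤ c₀ ∧ ∀ (κ C₁ c₅ : ℝ) (d : ℕ), 0 < κ → 0 < c₅ → 0 < d → ∃ KS : ℝ, 0 < KS ∧
    ∀ (X η τ V T Y Q₁ c₁ W : ℝ) (nn : ℕ) (m : Fin (nn + 1) → ℕ) (w : ℤ × ℤ × ℤ → ℝ),
      (∀ b, |w b| ≤ 1) → (∀ b u, DvdVec (d : ℤ) u → w (b + u) = w b) →
      0 ≤ η → η ≤ 1 → 0 < τ → τ ≤ 1 → CoreAdmissible τ m → Hyp314 X τ m ((d : ℝ) * Q₁) C₁ c₁ 3 1 →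
      2 ≤ X → 1 ≤ Real.log X → 1 ≤ Y → 1 ≤ Q₁ → Q₁ ≤ X → 2 ≤ T → T ^ 3 = V → T ≤ X → T ^ 2 ≤ 56 * X →
      W = X ^ (τ / 2) → X * W ≤ T ^ 3 → T ^ 2 * W ≤ X → Y ^ 10 * Q₁ ≤ T ^ 2 → c₅ * X * Y ^ 3 ≤ T ^ 3 →
      Y ≤ X → Q₁ ^ (1 / 3 : ℝ) * Real.exp (-(c₁ * Real.sqrt (Real.log (hbL X τ)))) ≤ 1 →
      2 ≤ T / ((1248 * (⌊Y⌋₊ + 1) ^ 2 : ℕ) : ℝ) →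
      3 * (((1248 * (⌊Y⌋₊ + 1) ^ 2 : ℕ)) : ℝ) + 2 ≤ (T / ((1248 * (⌊Y⌋₊ + 1) ^ 2 : ℕ) : ℝ)) ^ 2 →
      hbL X τ ^ 2 ≤ T / ((1248 * (⌊Y⌋₊ + 1) ^ 2 : ℕ) : ℝ) → X ≤ 270 * V →
      270 * V / X ≤ κ * (T / ((1248 * (⌊Y⌋₊ + 1) ^ 2 : ℕ) : ℝ)) →
      1 ≤ V / (X * Y) → V / (X * Y) ≤ T → 1 ≤ T ^ 3 * Y ^ 7 / X →
        ∑ a ∈ (Abox X T).filter IsPrimitiveVec,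
            (∑ b ∈ Bbox T, if Wab X η a b then w b * Fb X τ m V T b else 0) ^ 2 ≤
          KS * (X * V) * (Y⁻¹ + Y ^ 60 * X ^ (-(τ / 2)) + Y ^ 16 * Q₁ ^ (-(1 / 4 : ℝ)) +
            Y ^ 16 * Q₁ ^ 4 * Real.exp (-(c₁ * Real.sqrt (Real.log (hbL X τ))))) * Real.log X ^ c₀

/-! ### The Type II half: E3, E4 CLOSED (v5, v6); E5 CLOSED (v7) — no stub left -/

/-- **E3 CLOSED (v5) — `stub_classMainError` is a THEOREM.** `S_V^{cl} = M_V^{cl} + E_V^{cl}` with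
`|E_V^{cl}| ≤ C X² (X^τ)^{-1/2} (log X)^e` (absolute `C, e`): the lead `parity-ideate-ghb-prover-1` g3 landed
`Summit.Parity.GeneralizedHardyLittlewood.Theorems.GoldbachHeathBrownDispersionHeathBrownMorozUniform.stub_classMainError`
(p562045, `…ClassMainError.lean`: `classBilin_eq_sum_Hprim`, `classBilin_eq_main_add_error`, `abs_classError_le` — the class
filter rides along and the class error is dominated termwise by the tree's d = 1 majorant, `exists_errorEV_bound`), whose
statement is the registered signature `Sig.stub_classMainError` VERBATIM.  No longer a stub.
[cite: HeathBrownActa2001, §11 (11.2)] [cite: HeathBrownMoroz2004, Proposition 4.2] -/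
theorem classMainError_holds : Sig.stub_classMainError :=
  Summit.Parity.GeneralizedHardyLittlewood.Theorems.GoldbachHeathBrownDispersionHeathBrownMorozUniform.stub_classMainError

/-- **E4 CLOSED (v6) — `stub_classMainCauchy` is a THEOREM.** The residue split of the class main term `M_V^{cl}`
over the `d³` residues `v` of `β̂ (mod d)` followed by Cauchy's inequality (HB01 p. 68; HBM04 p. 23): the lead
`parity-ideate-ghb-prover-1` g3 landed
`Summit.Parity.GeneralizedHardyLittlewood.Theorems.GoldbachHeathBrownDispersionHeathBrownMorozUniform.stub_classMainCauchy`
(p562571, `…ClassMainCauchy.lean`: `cls_imulVec_iff` — the class of `α̂β̂` depends on `β̂ (mod d)` only —,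
`classMain_eq_sum_cA`, `inner_cls_eq_sum_resVecs`), whose statement is the registered signature `Sig.stub_classMainCauchy`
VERBATIM.  No longer a stub. [cite: HeathBrownActa2001, §11 p. 68] [cite: HeathBrownMoroz2004, Proposition 4.2] -/
theorem classMainCauchy_holds : Sig.stub_classMainCauchy :=
  Summit.Parity.GeneralizedHardyLittlewood.Theorems.GoldbachHeathBrownDispersionHeathBrownMorozUniform.stub_classMainCauchy


/-- **E5 CLOSED (v7) — `stub_twistedSsum` is a THEOREM.** Heath-Brown's dispersion bound (Lemma 12.2 + §13) for the
`S`-sum TWISTED by a `d`-periodic weight `w(β̂)`, `|w| ≤ 1`, with (3.14) up to `d·Q₁` and a `d`-dependent constant — the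
same four-term bound `S ≪_d XV (Y⁻¹ + Y⁶⁰X^{-τ/2} + Y¹⁶Q₁^{-1/4} + Y¹⁶Q₁⁴e^{-c₁√log L}) (log X)^{c₀}`: the lead
`parity-ideate-ghb-prover-1` g3 carried the twist through the tree's §§11–13 chain
(`Literature/NumberTheory/Sieve/HeathBrownCubicTwisted{Defs,Cauchy,Localise,SmallQ,ClassISum,UstarBound,S4Bound,Ssum}.lean`,
p559220 … p564660, `CubicSieve.Twisted.Ssum_le_of_params`; the ONE arithmetic step is `…TwistedSmallQ`: each class
`β̂ ≡ r (d)` inside `g ∣ β̂, β̂ ≡ c (q)` is empty or one class modulo `lcm(g,q,d) ≤ d·Q₁`, where `Hyp314 X τ m (d·Q₁)` applies)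
and landed `Summit.Parity.GeneralizedHardyLittlewood.Theorems.GoldbachHeathBrownDispersionHeathBrownMorozUniform.stub_twistedSsum`
(p565095, `Theorems/GoldbachHeathBrownDispersionHeathBrownMorozUniformTwistedSsum.lean`), whose statement is the registered signature
`Sig.stub_twistedSsum` VERBATIM.  No longer a stub; no `stub_*` declaration remains in this file.
[cite: HeathBrownActa2001, Lemma 12.2, §13 pp. 82–83] [cite: HeathBrownMoroz2004, Proposition 4.2] -/
theorem twistedSsum_holds : Sig.stub_twistedSsum :=
  Summit.Parity.GeneralizedHardyLittlewood.Theorems.GoldbachHeathBrownDispersionHeathBrownMorozUniform.stub_twistedSsum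

/-! ### Proved glue: from the three Type II stubs to the class Lemma 3.10 -/

/-- `D ∣ u` componentwise ⇒ (`D ∣ b + u − v` componentwise iff `D ∣ b − v` componentwise). [folklore] -/
theorem dvdVec_add_sub_iff {D : ℤ} {b u v : ℤ × ℤ × ℤ} (hu : DvdVec D u) :
    DvdVec D (b + u - v) ↔ DvdVec D (b - v) := by
  obtain ⟨h1, h2, h3⟩ := hu
  have key : ∀ {x y z : ℤ}, D ∣ y → (D ∣ x + y - z ↔ D ∣ x - z) := by
    intro x y z hy
    rw [show x + y - z = (x - z) + y by ring]
    exact dvd_add_left hy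
  simp only [DvdVec, Prod.fst_add, Prod.snd_add, Prod.fst_sub, Prod.snd_sub]
  rw [key h1, key h2, key h3]

set_option maxHeartbeats 1600000 in
open scoped Classical in
/-- **Class `SV_le_of_params`** (Lemma 12.2 with §13 for the class family): under the parameter
inequalities of the tree's `SV_le_of_params`, with (3.14) up to `d·Q₁`,
`|S_V^{cl}| ≤ K·X²·(Y^{−1/2} + Y³⁰X^{−τ/4} + Y⁸Q₁^{−1/8} + Y⁸Q₁²e^{−(c₁/2)√(log L)})(log X)^{c₀}`,
`K = K(d, κ, C₁, c₅)` — from stubs 3, 4, 5 (main + error, residue split + Cauchy, twisted `S`), the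
arithmetic being that of the tree's `SV_le_of_params`. [cite: HeathBrownActa2001, Lemma 12.2, §13 p. 83] -/
theorem classSV_le_of_params (h3 : Sig.stub_classMainError) (h4 : Sig.stub_classMainCauchy)
    (h5 : Sig.stub_twistedSsum) :
    ∃ c₀ : ℝ, 0 ≤ c₀ ∧ ∀ (κ C₁ c₅ : ℝ) (d : ℕ), 0 < κ → 0 < c₅ → 0 < d → ∃ Kc : ℝ, 0 < Kc ∧
      ∀ (X η τ V T Y Q₁ c₁ W : ℝ) (nn : ℕ) (m : Fin (nn + 1) → ℕ) (cR : Ideal (𝓞 K) → ℝ) (a₀ b₀ : ℕ),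
        0 ≤ η → η ≤ 1 → 0 < τ → τ ≤ 1 → CoreAdmissible τ m → Hyp314 X τ m ((d : ℝ) * Q₁) C₁ c₁ 3 1 →
        CSupport X τ cR →
        2 ≤ X → 1 ≤ Real.log X → 1 ≤ Y → 1 ≤ Q₁ → Q₁ ≤ X → 2 ≤ T → T ^ 3 = V → T ≤ X → T ^ 2 ≤ 56 * X →
        W = X ^ (τ / 2) → X * W ≤ T ^ 3 → T ^ 2 * W ≤ X → Y ^ 10 * Q₁ ≤ T ^ 2 → c₅ * X * Y ^ 3 ≤ T ^ 3 →
        Y ≤ X → Q₁ ^ (1 / 3 : ℝ) * Real.exp (-(c₁ * Real.sqrt (Real.log (hbL X τ)))) ≤ 1 →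
        2 ≤ T / ((1248 * (⌊Y⌋₊ + 1) ^ 2 : ℕ) : ℝ) →
        3 * (((1248 * (⌊Y⌋₊ + 1) ^ 2 : ℕ)) : ℝ) + 2 ≤ (T / ((1248 * (⌊Y⌋₊ + 1) ^ 2 : ℕ) : ℝ)) ^ 2 →
        hbL X τ ^ 2 ≤ T / ((1248 * (⌊Y⌋₊ + 1) ^ 2 : ℕ) : ℝ) → X ≤ 270 * V →
        270 * V / X ≤ κ * (T / ((1248 * (⌊Y⌋₊ + 1) ^ 2 : ℕ) : ℝ)) →
        1 ≤ V / (X * Y) → V / (X * Y) ≤ T → 1 ≤ T ^ 3 * Y ^ 7 / X →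
        |bilin (classPairs X η d a₀ b₀) pairIdeal cR (gCut X τ m V)| ≤
          Kc * X ^ 2 * (Y ^ (-(1 / 2 : ℝ)) + Y ^ 30 * X ^ (-(τ / 4)) + Y ^ 8 * Q₁ ^ (-(1 / 8 : ℝ)) +
            Y ^ 8 * Q₁ ^ 2 * Real.exp (-(c₁ / 2 * Real.sqrt (Real.log (hbL X τ))))) * Real.log X ^ c₀ := by
  classical
  obtain ⟨CE, eE, hCE, heE, hErr⟩ := h3
  obtain ⟨c₀, hc₀0, H5⟩ := h5
  refine ⟨c₀ + eE, by positivity, fun κ C₁ c₅ d hκ hc₅ hd => ?_⟩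
  obtain ⟨KS, hKS0, HK⟩ := H5 κ C₁ c₅ d hκ hc₅ hd
  have hd0 : (0 : ℝ) < d := Nat.cast_pos.mpr hd
  refine ⟨(d : ℝ) ^ 3 * Real.sqrt (3375 * KS) + CE, by positivity, ?_⟩
  intro X η τ V T Y Q₁ c₁ W nn m cR a₀ b₀ hη0 hη1 hτ hτ1 hm hHyp hcR hX hlogX hY hQ₁ hQ₁X hT2 hTV hTX hT56 hW
    hXW hTW hYQ hc₅V hYX hQe hs2 hsN hsL hVX hκs hΔ1 hΔT hd₀
  have hX0 : 0 < X := by linarith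
  have hT : 0 < T := by linarith
  have hY0 : 0 < Y := by linarith
  have hQ₁0 : 0 < Q₁ := by linarith
  have hV0 : 0 < V := by rw [← hTV]; positivity
  -- the three inputs, instantiated
  have hM1 := h4 X η τ V T (nn + 1) m cR d a₀ b₀ hX0 hη1 hT hTV hcR hd
  have hE1 := hErr X η τ V T nn m cR d a₀ b₀ hX hη0 hη1 hτ hτ1 hT hm hcR
  have hSvB : ∀ v : ℤ × ℤ × ℤ,
      ∑ a ∈ (Abox X T).filter IsPrimitiveVec,
          (∑ b ∈ Bbox T, if Wab X η a b then
              (if DvdVec (d : ℤ) (b - v) then (1 : ℝ) else 0) * Fb X τ m V T b else 0) ^ 2 ≤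
        KS * (X * V) * (Y⁻¹ + Y ^ 60 * X ^ (-(τ / 2)) + Y ^ 16 * Q₁ ^ (-(1 / 4 : ℝ)) +
          Y ^ 16 * Q₁ ^ 4 * Real.exp (-(c₁ * Real.sqrt (Real.log (hbL X τ))))) * Real.log X ^ c₀ := by
    intro v
    have hw1 : ∀ b : ℤ × ℤ × ℤ, |(if DvdVec (d : ℤ) (b - v) then (1 : ℝ) else 0)| ≤ 1 := by
      intro b; split_ifs <;> simp
    have hw2 : ∀ b u : ℤ × ℤ × ℤ, DvdVec (d : ℤ) u →
        (if DvdVec (d : ℤ) (b + u - v) then (1 : ℝ) else 0) =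
          (if DvdVec (d : ℤ) (b - v) then (1 : ℝ) else 0) := by
      intro b u hu
      rw [show (DvdVec (d : ℤ) (b + u - v)) = (DvdVec (d : ℤ) (b - v)) from propext (dvdVec_add_sub_iff hu)]
    exact HK X η τ V T Y Q₁ c₁ W nn m (fun b => if DvdVec (d : ℤ) (b - v) then (1 : ℝ) else 0) hw1 hw2
      hη0 hη1 hτ hτ1 hm hHyp hX hlogX hY hQ₁ hQ₁X hT2 hTV hTX hT56 hW hXW hTW hYQ hc₅V hYX hQe hs2 hsN hsL
      hVX hκs hΔ1 hΔT hd₀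
  -- the four terms
  obtain ⟨e₁, e₂', e₃', e₄⟩ :=
    four_terms_sq (τ := τ) (c := c₁) (u := Real.sqrt (Real.log (hbL X τ))) hX0 hY0 hQ₁0
  set U : ℝ := Y⁻¹ + Y ^ 60 * X ^ (-(τ / 2)) + Y ^ 16 * Q₁ ^ (-(1 / 4 : ℝ)) +
    Y ^ 16 * Q₁ ^ 4 * Real.exp (-(c₁ * Real.sqrt (Real.log (hbL X τ)))) with hU
  have hUt : U = (Y ^ (-(1 / 2 : ℝ))) ^ 2 + (Y ^ 30 * X ^ (-(τ / 4))) ^ 2 + (Y ^ 8 * Q₁ ^ (-(1 / 8 : ℝ))) ^ 2 +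
      (Y ^ 8 * Q₁ ^ 2 * Real.exp (-(c₁ / 2 * Real.sqrt (Real.log (hbL X τ))))) ^ 2 := by
    rw [hU, e₁, e₂', e₃', e₄]
  have ht₁0 : 0 ≤ Y ^ (-(1 / 2 : ℝ)) := Real.rpow_nonneg hY0.le _
  have ht₂0 : 0 ≤ Y ^ 30 * X ^ (-(τ / 4)) := mul_nonneg (by positivity) (Real.rpow_nonneg hX0.le _)
  have ht₃0 : 0 ≤ Y ^ 8 * Q₁ ^ (-(1 / 8 : ℝ)) := mul_nonneg (by positivity) (Real.rpow_nonneg hQ₁0.le _)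
  have ht₄0 : 0 ≤ Y ^ 8 * Q₁ ^ 2 * Real.exp (-(c₁ / 2 * Real.sqrt (Real.log (hbL X τ)))) := by positivity
  have hU0 : 0 ≤ U := by rw [hUt]; positivity
  set St : ℝ := Y ^ (-(1 / 2 : ℝ)) + Y ^ 30 * X ^ (-(τ / 4)) + Y ^ 8 * Q₁ ^ (-(1 / 8 : ℝ)) +
    Y ^ 8 * Q₁ ^ 2 * Real.exp (-(c₁ / 2 * Real.sqrt (Real.log (hbL X τ)))) with hSt
  have hsqrtU : Real.sqrt U ≤ St := by rw [hUt]; exact sqrt_sum_four_le ht₁0 ht₂0 ht₃0 ht₄0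
  have hSt0 : 0 ≤ St := by positivity
  have ht₂St : X ^ (-(τ / 4)) ≤ St := by
    have h2 : X ^ (-(τ / 4)) ≤ Y ^ 30 * X ^ (-(τ / 4)) :=
      le_mul_of_one_le_left (Real.rpow_nonneg hX0.le _) (one_le_pow₀ hY)
    linarith
  -- logarithms
  set LX := Real.log X with hLX
  have hLX0 : 0 ≤ LX := by linarith
  -- the twisted `S(v)` are uniformly bounded by `B`
  set B : ℝ := KS * (X * V) * U * LX ^ c₀ with hB
  have hB0 : 0 ≤ B :=
    mul_nonneg (mul_nonneg (mul_nonneg hKS0.le (mul_pos hX0 hV0).le) hU0) (Real.rpow_nonneg hLX0 _)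
  -- the residue set has `d³` elements
  have hcard : (#(Finset.Ico (0 : ℤ) d ×ˢ (Finset.Ico (0 : ℤ) d ×ˢ Finset.Ico (0 : ℤ) d)) : ℝ) = (d : ℝ) ^ 3 := by
    rw [card_product, card_product, Int.card_Ico, sub_zero, Int.toNat_natCast]
    push_cast; ring
  have hsum : ∑ v ∈ Finset.Ico (0 : ℤ) d ×ˢ (Finset.Ico (0 : ℤ) d ×ˢ Finset.Ico (0 : ℤ) d),
      Real.sqrt (∑ a ∈ (Abox X T).filter IsPrimitiveVec,
        (∑ b ∈ Bbox T, if Wab X η a b then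
            (if DvdVec (d : ℤ) (b - v) then (1 : ℝ) else 0) * Fb X τ m V T b else 0) ^ 2) ≤
      (d : ℝ) ^ 3 * Real.sqrt B := by
    refine (sum_le_sum fun v _ => Real.sqrt_le_sqrt (hSvB v)).trans ?_
    rw [sum_const, nsmul_eq_mul, hcard]
  -- `#Abox ≤ (15X/T)³`
  have hA : (#(Abox X T) : ℝ) ≤ (15 * X / T) ^ 3 := by
    refine (card_Abox_le hX0.le hT).trans ?_
    have : 14 * X / T + 1 ≤ 15 * X / T := by
      rw [div_add_one hT.ne', div_le_div_iff_of_pos_right hT]; linarith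
    exact pow_le_pow_left₀ (by positivity) this 3
  -- the core computation of p. 68 / p. 83: `(#Abox)^{1/2} B^{1/2} ≤ √(3375 KS) X² St LX^{c₀+eE}`
  have hcore : Real.sqrt (#(Abox X T)) * Real.sqrt B ≤ Real.sqrt (3375 * KS) * X ^ 2 * St * LX ^ (c₀ + eE) := by
    have h1 : Real.sqrt (#(Abox X T)) * Real.sqrt B ≤ Real.sqrt ((15 * X / T) ^ 3) * Real.sqrt B :=
      mul_le_mul_of_nonneg_right (Real.sqrt_le_sqrt hA) (Real.sqrt_nonneg _)
    refine h1.trans ?_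
    rw [← Real.sqrt_mul (by positivity)]
    have e : (15 * X / T) ^ 3 * B = (3375 * KS) * (X ^ 2) ^ 2 * (U * LX ^ c₀) := by
      rw [hB, ← hTV]; field_simp; ring
    rw [e, Real.sqrt_mul (by positivity), Real.sqrt_mul (by positivity), Real.sqrt_sq (by positivity),
      Real.sqrt_mul hU0]
    have hL1 : Real.sqrt (LX ^ c₀) ≤ LX ^ (c₀ + eE) := by
      rw [Real.sqrt_eq_rpow, ← Real.rpow_mul hLX0]
      exact Real.rpow_le_rpow_of_exponent_le hlogX (by linarith)
    have hL0 : 0 ≤ Real.sqrt (LX ^ c₀) := Real.sqrt_nonneg _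
    calc Real.sqrt (3375 * KS) * X ^ 2 * (Real.sqrt U * Real.sqrt (LX ^ c₀))
        ≤ Real.sqrt (3375 * KS) * X ^ 2 * (St * LX ^ (c₀ + eE)) := by gcongr
      _ = _ := by ring
  -- the main term
  have hmain : |∑ xy ∈ (box X η).filter (fun xy => xy.1 ≡ a₀ [MOD d] ∧ xy.2 ≡ b₀ [MOD d]),
      Hprim X τ m V T cR xy| ≤ (d : ℝ) ^ 3 * Real.sqrt (3375 * KS) * X ^ 2 * St * LX ^ (c₀ + eE) := by
    refine hM1.trans ?_
    calc Real.sqrt (#(Abox X T)) *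
          ∑ v ∈ Finset.Ico (0 : ℤ) d ×ˢ (Finset.Ico (0 : ℤ) d ×ˢ Finset.Ico (0 : ℤ) d),
            Real.sqrt (∑ a ∈ (Abox X T).filter IsPrimitiveVec,
              (∑ b ∈ Bbox T, if Wab X η a b then
                  (if DvdVec (d : ℤ) (b - v) then (1 : ℝ) else 0) * Fb X τ m V T b else 0) ^ 2)
        ≤ Real.sqrt (#(Abox X T)) * ((d : ℝ) ^ 3 * Real.sqrt B) :=
          mul_le_mul_of_nonneg_left hsum (Real.sqrt_nonneg _)
      _ = (d : ℝ) ^ 3 * (Real.sqrt (#(Abox X T)) * Real.sqrt B) := by ring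
      _ ≤ (d : ℝ) ^ 3 * (Real.sqrt (3375 * KS) * X ^ 2 * St * LX ^ (c₀ + eE)) :=
          mul_le_mul_of_nonneg_left hcore (by positivity)
      _ = _ := by ring
  -- the error term
  have herr : |bilin (classPairs X η d a₀ b₀) pairIdeal cR (gCut X τ m V) -
      ∑ xy ∈ (box X η).filter (fun xy => xy.1 ≡ a₀ [MOD d] ∧ xy.2 ≡ b₀ [MOD d]), Hprim X τ m V T cR xy| ≤
      CE * X ^ 2 * St * LX ^ (c₀ + eE) := by
    have hXt : (X ^ τ) ^ (-(1 / 2 : ℝ)) ≤ St := by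
      have e : (X ^ τ) ^ (-(1 / 2 : ℝ)) = X ^ (-(τ / 2)) := by rw [← Real.rpow_mul hX0.le]; ring_nf
      rw [e]
      have h1 : X ^ (-(τ / 2)) ≤ X ^ (-(τ / 4)) := Real.rpow_le_rpow_of_exponent_le (by linarith) (by linarith)
      linarith
    have hLe : LX ^ eE ≤ LX ^ (c₀ + eE) := Real.rpow_le_rpow_of_exponent_le hlogX (by linarith)
    have hX0' : 0 ≤ (X ^ τ) ^ (-(1 / 2 : ℝ)) := Real.rpow_nonneg (Real.rpow_nonneg hX0.le _) _
    calc |bilin (classPairs X η d a₀ b₀) pairIdeal cR (gCut X τ m V) -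
          ∑ xy ∈ (box X η).filter (fun xy => xy.1 ≡ a₀ [MOD d] ∧ xy.2 ≡ b₀ [MOD d]), Hprim X τ m V T cR xy|
        ≤ CE * X ^ 2 * (X ^ τ) ^ (-(1 / 2 : ℝ)) * LX ^ eE := hE1
      _ ≤ CE * X ^ 2 * St * LX ^ (c₀ + eE) := by gcongr
  -- `S_V^{cl} = M + E`
  have hsplit : bilin (classPairs X η d a₀ b₀) pairIdeal cR (gCut X τ m V) =
      (∑ xy ∈ (box X η).filter (fun xy => xy.1 ≡ a₀ [MOD d] ∧ xy.2 ≡ b₀ [MOD d]), Hprim X τ m V T cR xy) +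
        (bilin (classPairs X η d a₀ b₀) pairIdeal cR (gCut X τ m V) -
          ∑ xy ∈ (box X η).filter (fun xy => xy.1 ≡ a₀ [MOD d] ∧ xy.2 ≡ b₀ [MOD d]), Hprim X τ m V T cR xy) := by
    ring
  rw [hsplit]
  refine (abs_add_le _ _).trans ?_
  calc |∑ xy ∈ (box X η).filter (fun xy => xy.1 ≡ a₀ [MOD d] ∧ xy.2 ≡ b₀ [MOD d]), Hprim X τ m V T cR xy| +
        |bilin (classPairs X η d a₀ b₀) pairIdeal cR (gCut X τ m V) -
          ∑ xy ∈ (box X η).filter (fun xy => xy.1 ≡ a₀ [MOD d] ∧ xy.2 ≡ b₀ [MOD d]), Hprim X τ m V T cR xy|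
      ≤ (d : ℝ) ^ 3 * Real.sqrt (3375 * KS) * X ^ 2 * St * LX ^ (c₀ + eE) + CE * X ^ 2 * St * LX ^ (c₀ + eE) :=
        add_le_add hmain herr
    _ = ((d : ℝ) ^ 3 * Real.sqrt (3375 * KS) + CE) * X ^ 2 * St * LX ^ (c₀ + eE) := by ring

set_option maxHeartbeats 2000000 in
open scoped Classical in
/-- **The class bound of p. 83**: `S_V^{cl} ≤ C X²(Y^{−1/2} + Y³⁰X^{−τ/4} + Y⁸Q₁^{−1/8} + Y⁸Q₁²e^{−c₂√(log L)})(log X)^c`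
for `X ≥ X₀`, `1 ≤ Y ≤ X^{τ/3}`, under (3.14) up to `d·Q₁` with `c₃ = 3`, `c₄ = 1` — the tree's
`SV_bound_p83` for the class family (`T = V^{1/3}`, `final_param_ineqs`, `eventually_final_params`).
[cite: HeathBrownActa2001, §13 p. 83] -/
theorem class_p83 (h3 : Sig.stub_classMainError) (h4 : Sig.stub_classMainCauchy)
    (h5 : Sig.stub_twistedSsum) : ∀ d a₀ b₀ : ℕ, 0 < d → ∀ ϖ : ℝ, 0 < ϖ → ϖ < 1 / 5 →
    ∃ c c₃ c₄ : ℝ, 0 < c₃ ∧ 0 < c₄ ∧ ∀ C₁ c₁ c₅ c₆ : ℝ, 0 < c₁ → 0 < c₅ → 0 < c₆ →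
      ∃ C c₂ X₀ : ℝ, 0 < c₂ ∧ ∀ X η Q₁ Y : ℝ, X₀ ≤ X → Real.exp (-Real.log X ^ (1 / 3 : ℝ)) ≤ η →
        η ≤ 1 → 1 ≤ Q₁ → Q₁ ≤ Real.exp (Real.log X ^ (1 / 3 : ℝ)) → 1 ≤ Y →
          Y ≤ X ^ (hbTau ϖ X / 3) →
          (∀ (k' : ℕ) (m' : Fin k' → ℕ), CoreAdmissible (hbTau ϖ X) m' →
            Hyp314 X (hbTau ϖ X) m' ((d : ℝ) * Q₁) C₁ c₁ c₃ c₄) →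
            ∀ (k : ℕ) (m : Fin k → ℕ), CoreAdmissible (hbTau ϖ X) m →
              ∀ cR : Ideal (𝓞 K) → ℝ, CSupport X (hbTau ϖ X) cR →
                ∀ V : ℝ, c₅ * X ^ (1 + hbTau ϖ X) ≤ V → V ≤ c₆ * X ^ (3 / 2 - hbTau ϖ X) →
                  |bilin (classPairs X η d a₀ b₀) pairIdeal cR
                      (fun S => if V < (Ideal.absNorm S : ℝ) ∧ (Ideal.absNorm S : ℝ) ≤ 2 * V then
                        fWeight X (hbTau ϖ X) m S else 0)| ≤
                    C * X ^ 2 * (Y ^ (-(1 / 2 : ℝ)) + Y ^ 30 * X ^ (-(hbTau ϖ X / 4)) +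
                      Y ^ 8 * Q₁ ^ (-(1 / 8 : ℝ)) +
                      Y ^ 8 * Q₁ ^ 2 * Real.exp (-(c₂ * Real.sqrt (Real.log (hbL X (hbTau ϖ X)))))) *
                      Real.log X ^ c := by
  intro d a₀ b₀ hd ϖ hϖ0 _hϖ5
  obtain ⟨c₀, -, H⟩ := classSV_le_of_params h3 h4 h5
  refine ⟨c₀, 3, 1, by norm_num, by norm_num, fun C₁ c₁ c₅ c₆ hc₁ hc₅ hc₆ => ?_⟩
  have hκ0 : (0 : ℝ) < 270 * 4992 * (c₆ ^ (1 / 3 : ℝ)) ^ 2 + 1 := by positivity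
  obtain ⟨Kc, hKc, HK⟩ := H _ C₁ c₅ d hκ0 hc₅ hd
  obtain ⟨X₀, hX₀⟩ := Filter.eventually_atTop.mp
    (eventually_final_params hϖ0 ((c₆ ^ (1 / 3 : ℝ)) ^ 2 + 1 / c₅ + 1 / (270 * c₅) + 1)
      (2 / c₅ ^ (1 / 3 : ℝ) + c₆ ^ (1 / 3 : ℝ) + 2 * 4992 / c₅ ^ (1 / 3 : ℝ) +
        24960 * 4992 ^ 2 / (c₅ ^ (1 / 3 : ℝ)) ^ 2 + 4992 / c₅ ^ (1 / 3 : ℝ) + 1) hc₁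
      (Real.rpow_pos_of_pos hc₅ (2 / 3 : ℝ)))
  refine ⟨Kc, c₁ / 2, X₀, by positivity, ?_⟩
  intro X η Q₁ Y hXX₀ hη1 hη2 hQ₁ hQ₁2 hY1 hY2 hHyp k m hm cR hcR V hV1 hV2
  obtain ⟨hX2, hL1, hτ0, hτ8, hP, hR, hE7, hC8⟩ := hX₀ X hXX₀
  -- no admissible `𝐦` with `k = 0`
  cases k with
  | zero => exact (not_coreAdmissible_zero hτ0 m hm).elim
  | succ n =>
  obtain ⟨hQ₁X, hT2, hTV, hTX, hT56, hXW, hT2W, hYQ, hc₅V, hYX, hQe, hs2, hsN, hsL, hVX, hκs, hΔ1, hΔT, hd₀⟩ :=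
    final_param_ineqs (c₁ := c₁) hX2 hL1 hτ0 hτ8 hc₅ hc₆ hP hR hE7 hC8 hV1 hV2 hY1 hY2 hQ₁ hQ₁2
  have hη0 : 0 ≤ η := le_trans (Real.exp_pos _).le hη1
  have hτ1 : hbTau ϖ X ≤ 1 := by linarith
  -- apply the core bound
  have hmain := HK X η (hbTau ϖ X) V (V ^ (1 / 3 : ℝ)) Y Q₁ c₁ (X ^ (hbTau ϖ X / 2)) n m cR a₀ b₀ hη0 hη2 hτ0
    hτ1 hm (hHyp _ m hm) hcR hX2 hL1 hY1 hQ₁ hQ₁X hT2 hTV hTX hT56 rfl hXW hT2W hYQ hc₅V hYX hQe hs2 hsN hsL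
    hVX hκs hΔ1 hΔT hd₀
  have hg : (fun S : Ideal (𝓞 K) => if V < (Ideal.absNorm S : ℝ) ∧ (Ideal.absNorm S : ℝ) ≤ 2 * V then
      fWeight X (hbTau ϖ X) m S else 0) = gCut X (hbTau ϖ X) m V := by
    funext S; unfold gCut; congr 1
  rw [hg]
  exact hmain

open scoped Classical in
/-- **Class Lemma 3.10 by the choice `Y = Q₁^{1/80}` ((13.7))** — the tree's
`HeathBrown2001_lemma_3_10_of_SV_bound` for the class family, with (3.14) up to `d·Q₁`:
`S_V^{cl} ≪ X² Q₁^{−1/160} (log X)^c`. [cite: HeathBrownActa2001, §13 p. 83, (13.7)] -/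
theorem class_310 (h3 : Sig.stub_classMainError) (h4 : Sig.stub_classMainCauchy)
    (h5 : Sig.stub_twistedSsum) : ∀ d a₀ b₀ : ℕ, 0 < d → ∀ ϖ : ℝ, 0 < ϖ → ϖ < 1 / 5 →
    ∃ c c₃ c₄ : ℝ, 0 < c₃ ∧ 0 < c₄ ∧ ∀ C₁ c₁ c₅ c₆ : ℝ, 0 < c₁ → 0 < c₅ → 0 < c₆ →
      ∃ C X₀ : ℝ, ∀ X η Q₁ : ℝ, X₀ ≤ X → Real.exp (-Real.log X ^ (1 / 3 : ℝ)) ≤ η → η ≤ 1 →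
        1 ≤ Q₁ → Q₁ ≤ Real.exp (Real.log X ^ (1 / 3 : ℝ)) →
          (∀ (k' : ℕ) (m' : Fin k' → ℕ), CoreAdmissible (hbTau ϖ X) m' →
            Hyp314 X (hbTau ϖ X) m' ((d : ℝ) * Q₁) C₁ c₁ c₃ c₄) →
            ∀ (k : ℕ) (m : Fin k → ℕ), CoreAdmissible (hbTau ϖ X) m →
              ∀ cR : Ideal (𝓞 K) → ℝ, CSupport X (hbTau ϖ X) cR →
                ∀ V : ℝ, c₅ * X ^ (1 + hbTau ϖ X) ≤ V → V ≤ c₆ * X ^ (3 / 2 - hbTau ϖ X) →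
                  |bilin (classPairs X η d a₀ b₀) pairIdeal cR
                      (fun S => if V < (Ideal.absNorm S : ℝ) ∧ (Ideal.absNorm S : ℝ) ≤ 2 * V then
                        fWeight X (hbTau ϖ X) m S else 0)| ≤
                    C * X ^ 2 * Q₁ ^ (-(1 / 160 : ℝ)) * Real.log X ^ c := by
  intro d a₀ b₀ hd ϖ hϖ0 hϖ5
  obtain ⟨c, c₃, c₄, hc₃, hc₄, H⟩ := class_p83 h3 h4 h5 d a₀ b₀ hd ϖ hϖ0 hϖ5
  refine ⟨c, c₃, c₄, hc₃, hc₄, fun C₁ c₁ c₅ c₆ hc₁ hc₅ hc₆ => ?_⟩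
  obtain ⟨C, c₂, X₀, hc₂, HX⟩ := H C₁ c₁ c₅ c₆ hc₁ hc₅ hc₆
  obtain ⟨X₁, hX₁⟩ := Filter.eventually_atTop.mp (eventually_reduction_params ϖ hc₂)
  refine ⟨4 * max C 0, max X₀ X₁,
    fun X η Q₁ hX hη1 hη2 hQ1 hQ2 hHyp k m hm cR hcR V hV1 hV2 => ?_⟩
  obtain ⟨hX2, hL1, hτpos, hA, hB, hC⟩ := hX₁ X (le_of_max_le_right hX)
  have hXX₀ : X₀ ≤ X := le_of_max_le_left hX
  have hX0 : 0 < X := by linarith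
  have hLpos : 0 < Real.log X := by linarith
  have hQpos : 0 < Q₁ := by linarith
  -- the choice `Y = Q₁^{1/80}`
  obtain ⟨Y, hYdef⟩ : ∃ Y : ℝ, Y = Q₁ ^ (1 / 80 : ℝ) := ⟨_, rfl⟩
  have hY1 : 1 ≤ Y := hYdef ▸ Real.one_le_rpow hQ1 (by norm_num)
  have hYpos : 0 < Y := by linarith
  have hQpow : ∀ a : ℝ, 0 ≤ a → Q₁ ^ a ≤ Real.exp (a * Real.log X ^ (1 / 3 : ℝ)) := by
    intro a ha
    calc Q₁ ^ a ≤ (Real.exp (Real.log X ^ (1 / 3 : ℝ))) ^ a := Real.rpow_le_rpow hQpos.le hQ2 ha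
      _ = Real.exp (a * Real.log X ^ (1 / 3 : ℝ)) := by rw [← Real.exp_mul, mul_comm]
  have hXpow : ∀ s : ℝ, X ^ s = Real.exp (s * Real.log X) := fun s => by
    rw [Real.rpow_def_of_pos hX0, mul_comm]
  have hYX : Y ≤ X ^ (hbTau ϖ X / 3) := by
    calc Y = Q₁ ^ (1 / 80 : ℝ) := hYdef
      _ ≤ Real.exp ((1 / 80) * Real.log X ^ (1 / 3 : ℝ)) := hQpow _ (by norm_num)
      _ ≤ Real.exp (hbTau ϖ X / 3 * Real.log X) :=
          Real.exp_le_exp.mpr (hA.trans_eq (by ring))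
      _ = X ^ (hbTau ϖ X / 3) := (hXpow _).symm
  have hmain := HX X η Q₁ Y hXX₀ hη1 hη2 hQ1 hQ2 hY1 hYX hHyp k m hm cR hcR V hV1 hV2
  -- the four terms are each `≤ T = Q₁^{-1/160}`
  obtain ⟨T, hT⟩ : ∃ T : ℝ, T = Q₁ ^ (-(1 / 160 : ℝ)) := ⟨_, rfl⟩
  have hTpos : 0 < T := hT ▸ Real.rpow_pos_of_pos hQpos _
  have h1 : Y ^ (-(1 / 2 : ℝ)) = T := by
    rw [hYdef, hT, ← Real.rpow_mul hQpos.le]; norm_num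
  have h2 : Y ^ 30 * X ^ (-(hbTau ϖ X / 4)) ≤ T := by
    have e1 : Y ^ 30 = Q₁ ^ (3 / 8 : ℝ) := by
      rw [hYdef, ← Real.rpow_natCast, ← Real.rpow_mul hQpos.le]; norm_num
    have e2 : Q₁ ^ (3 / 8 : ℝ) = T * Q₁ ^ (61 / 160 : ℝ) := by
      rw [hT, ← Real.rpow_add hQpos]; norm_num
    have e3 : Q₁ ^ (61 / 160 : ℝ) ≤ X ^ (hbTau ϖ X / 4) := by
      calc Q₁ ^ (61 / 160 : ℝ) ≤ Real.exp ((61 / 160) * Real.log X ^ (1 / 3 : ℝ)) :=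
            hQpow _ (by norm_num)
        _ ≤ Real.exp (hbTau ϖ X / 4 * Real.log X) :=
            Real.exp_le_exp.mpr (hB.trans_eq (by ring))
        _ = X ^ (hbTau ϖ X / 4) := (hXpow _).symm
    have hXτ : 0 < X ^ (hbTau ϖ X / 4) := Real.rpow_pos_of_pos hX0 _
    rw [e1, e2, Real.rpow_neg hX0.le, mul_assoc]
    calc T * (Q₁ ^ (61 / 160 : ℝ) * (X ^ (hbTau ϖ X / 4))⁻¹) ≤ T * 1 := by
          refine mul_le_mul_of_nonneg_left ?_ hTpos.le
          rw [mul_inv_le_iff₀ hXτ, one_mul]; exact e3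
      _ = T := mul_one T
  have h3' : Y ^ 8 * Q₁ ^ (-(1 / 8 : ℝ)) ≤ T := by
    have e1 : Y ^ 8 * Q₁ ^ (-(1 / 8 : ℝ)) = Q₁ ^ (-(1 / 40 : ℝ)) := by
      rw [hYdef, ← Real.rpow_natCast, ← Real.rpow_mul hQpos.le, ← Real.rpow_add hQpos]
      norm_num
    rw [e1, hT]
    exact Real.rpow_le_rpow_of_exponent_le hQ1 (by norm_num)
  have h4' : Y ^ 8 * Q₁ ^ 2 * Real.exp (-(c₂ * Real.sqrt (Real.log (hbL X (hbTau ϖ X))))) ≤ T := by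
    have e1 : Y ^ 8 * Q₁ ^ 2 = T * Q₁ ^ (337 / 160 : ℝ) := by
      rw [hYdef, ← Real.rpow_natCast, ← Real.rpow_mul hQpos.le, ← Real.rpow_natCast Q₁ 2,
        ← Real.rpow_add hQpos, hT, ← Real.rpow_add hQpos]
      norm_num
    have e2 : Real.log (hbL X (hbTau ϖ X)) = hbTau ϖ X * Real.log X / 2 := by
      rw [hbL, Real.log_rpow hX0]; ring
    have e3 : Q₁ ^ (337 / 160 : ℝ) ≤
        Real.exp (c₂ * Real.sqrt (Real.log (hbL X (hbTau ϖ X)))) := by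
      calc Q₁ ^ (337 / 160 : ℝ) ≤ Real.exp ((337 / 160) * Real.log X ^ (1 / 3 : ℝ)) :=
            hQpow _ (by norm_num)
        _ ≤ Real.exp (c₂ * Real.sqrt (Real.log (hbL X (hbTau ϖ X)))) := by
            rw [e2]; exact Real.exp_le_exp.mpr hC
    have hE : 0 < Real.exp (c₂ * Real.sqrt (Real.log (hbL X (hbTau ϖ X)))) := Real.exp_pos _
    rw [e1, Real.exp_neg, mul_assoc]
    calc T * (Q₁ ^ (337 / 160 : ℝ) *
          (Real.exp (c₂ * Real.sqrt (Real.log (hbL X (hbTau ϖ X)))))⁻¹) ≤ T * 1 := by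
          refine mul_le_mul_of_nonneg_left ?_ hTpos.le
          rw [mul_inv_le_iff₀ hE, one_mul]; exact e3
      _ = T := mul_one T
  -- assemble
  have hsum : Y ^ (-(1 / 2 : ℝ)) + Y ^ 30 * X ^ (-(hbTau ϖ X / 4)) + Y ^ 8 * Q₁ ^ (-(1 / 8 : ℝ)) +
      Y ^ 8 * Q₁ ^ 2 * Real.exp (-(c₂ * Real.sqrt (Real.log (hbL X (hbTau ϖ X))))) ≤ 4 * T := by
    rw [h1]; linarith
  have hsum0 : 0 ≤ Y ^ (-(1 / 2 : ℝ)) + Y ^ 30 * X ^ (-(hbTau ϖ X / 4)) +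
      Y ^ 8 * Q₁ ^ (-(1 / 8 : ℝ)) +
      Y ^ 8 * Q₁ ^ 2 * Real.exp (-(c₂ * Real.sqrt (Real.log (hbL X (hbTau ϖ X))))) := by
    positivity
  have hLc : 0 ≤ Real.log X ^ c := Real.rpow_nonneg hLpos.le _
  have hC0 : C ≤ max C 0 := le_max_left _ _
  have hM0 : 0 ≤ max C 0 := le_max_right _ _
  refine hmain.trans ?_
  calc C * X ^ 2 * (Y ^ (-(1 / 2 : ℝ)) + Y ^ 30 * X ^ (-(hbTau ϖ X / 4)) +
          Y ^ 8 * Q₁ ^ (-(1 / 8 : ℝ)) +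
          Y ^ 8 * Q₁ ^ 2 * Real.exp (-(c₂ * Real.sqrt (Real.log (hbL X (hbTau ϖ X)))))) *
        Real.log X ^ c
      ≤ max C 0 * X ^ 2 * (Y ^ (-(1 / 2 : ℝ)) + Y ^ 30 * X ^ (-(hbTau ϖ X / 4)) +
          Y ^ 8 * Q₁ ^ (-(1 / 8 : ℝ)) +
          Y ^ 8 * Q₁ ^ 2 * Real.exp (-(c₂ * Real.sqrt (Real.log (hbL X (hbTau ϖ X)))))) *
        Real.log X ^ c :=
        mul_le_mul_of_nonneg_right (mul_le_mul_of_nonneg_right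
          (mul_le_mul_of_nonneg_right hC0 (by positivity)) hsum0) hLc
    _ ≤ max C 0 * X ^ 2 * (4 * T) * Real.log X ^ c :=
        mul_le_mul_of_nonneg_right (mul_le_mul_of_nonneg_left hsum (by positivity)) hLc
    _ = 4 * max C 0 * X ^ 2 * Q₁ ^ (-(1 / 160 : ℝ)) * Real.log X ^ c := by rw [hT]; ring

/-- **`h310` of `heathBrownMorozUniform_of_classLemmas`** (the class Type II estimate, (3.14) up to `d·Q₁`,
`d·Q₁ ≤ exp((log X)^{1/3})`) from the three Type II stubs: `class_310` with `Q₁ ≤ d·Q₁`. -/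
theorem h310_of (h3 : Sig.stub_classMainError) (h4 : Sig.stub_classMainCauchy)
    (h5 : Sig.stub_twistedSsum) :
    ∀ d a b : ℕ, 0 < d → a < d → b < d → Nat.Coprime (a ^ 3 + 2 * b ^ 3) d →
      ∀ ϖ : ℝ, 0 < ϖ → ϖ < 1 / 5 →
        ∃ c c₃ c₄ : ℝ, 0 < c₃ ∧ 0 < c₄ ∧ ∀ C₁ c₁ c₅ c₆ : ℝ, 0 < c₁ → 0 < c₅ → 0 < c₆ →
          ∃ C X₀ : ℝ, ∀ X η Q₁ : ℝ, X₀ ≤ X → Real.exp (-Real.log X ^ (1 / 3 : ℝ)) ≤ η → η ≤ 1 →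
            1 ≤ Q₁ → (d : ℝ) * Q₁ ≤ Real.exp (Real.log X ^ (1 / 3 : ℝ)) →
              (∀ (k' : ℕ) (m' : Fin k' → ℕ), CoreAdmissible (hbTau ϖ X) m' →
                Hyp314 X (hbTau ϖ X) m' ((d : ℝ) * Q₁) C₁ c₁ c₃ c₄) →
                ∀ (k : ℕ) (m : Fin k → ℕ), CoreAdmissible (hbTau ϖ X) m →
                  ∀ cR : Ideal (𝓞 K) → ℝ, CSupport X (hbTau ϖ X) cR →
                    ∀ V : ℝ, c₅ * X ^ (1 + hbTau ϖ X) ≤ V → V ≤ c₆ * X ^ (3 / 2 - hbTau ϖ X) →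
                      |bilin (classPairs X η d a b) pairIdeal cR
                          (fun S => if V < (Ideal.absNorm S : ℝ) ∧ (Ideal.absNorm S : ℝ) ≤ 2 * V then
                            fWeight X (hbTau ϖ X) m S else 0)| ≤
                        C * X ^ 2 * Q₁ ^ (-(1 / 160 : ℝ)) * Real.log X ^ c := by
  intro d a b hd _ha _hb _hadm ϖ hϖ0 hϖ5
  obtain ⟨c, c₃, c₄, hc₃, hc₄, H⟩ := class_310 h3 h4 h5 d a b hd ϖ hϖ0 hϖ5
  refine ⟨c, c₃, c₄, hc₃, hc₄, fun C₁ c₁ c₅ c₆ hc₁ hc₅ hc₆ => ?_⟩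
  obtain ⟨C, X₀, HX⟩ := H C₁ c₁ c₅ c₆ hc₁ hc₅ hc₆
  refine ⟨C, X₀, fun X η Q₁ hX hη1 hη2 hQ1 hdQ hHyp k m hm cR hcR V hV1 hV2 => ?_⟩
  have hd1 : (1 : ℝ) ≤ d := Nat.one_le_cast.mpr hd
  have hQd : Q₁ ≤ (d : ℝ) * Q₁ := le_mul_of_one_le_left (by linarith) hd1
  exact HX X η Q₁ hX hη1 hη2 hQ1 (hQd.trans hdQ) hHyp k m hm cR hcR V hV1 hV2

/-- **Bridge between the two readings.** The sibling line's fourth stub `ClassTypeIIBound` (= `h310` verbatim)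
is DISCHARGED by this line's three Type II stubs (definitional unfolding of `ClassTypeIIBound`; proof = `h310_of`). -/
theorem classTypeIIBound_of (h3 : Sig.stub_classMainError) (h4 : Sig.stub_classMainCauchy)
    (h5 : Sig.stub_twistedSsum) : ClassTypeIIBound :=
  h310_of h3 h4 h5

/-- **S5 DISCHARGED inside the union skeleton (v3, v5):** the class Type II bound `ClassTypeIIBound` (= `h310`
verbatim) from E3, E4 (CLOSED: `classMainError_holds`, `classMainCauchy_holds`) and the ONE registered Type-II stub E5 of line
`unit-split-positivity` (its PROVED `classTypeIIBound_of`).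
[cite: HeathBrownMoroz2004, Prop. 4.2] [cite: HeathBrownActa2001, Lemma 3.10] -/
theorem classTypeII_holds : ClassTypeIIBound :=
  classTypeIIBound_of classMainError_holds classMainCauchy_holds twistedSsum_holds

/-! ### The composition: the crux from the (former) stubs — kernel-checked, and as of v7 sorry-free throughout -/

/-- **The line concludes the crux BY NAME (v4 shape, kept).**
`(ClassPairsTypeI → ClassTypeISqfreeSum → ClassSigmaOneCoprime → ClassDisplay104) → ClassTypeIIBound → HeathBrownMorozUniform`
(S2 = `flDifferencing_holds`, S3 = `sigmaOneCoprime_holds`, S4p = `classPairsTypeI_holds`, S4a = `classTypeISqfreeSum_holds`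
supplied internally): `h35` by differencing against the parent's Lemma 3.5 (`h35_of_flDifferencing`), `h39` by differencing
the class display (10.4) against the parent's and adding the parent's Lemma 3.9 (`classLeadingDifferencing_of_display104`,
`h39_of_leadingDifferencing`), then the tree's `heathBrownMorozUniform_of_classLemmas` (p544930).
[cite: HeathBrownMoroz2004, Theorem 2] -/
theorem HeathBrownMorozUniform_of
    (h₄ : ClassPairsTypeI → ClassTypeISqfreeSum → ClassSigmaOneCoprime → ClassDisplay104)
    (h₅ : ClassTypeIIBound) :
    Summit.Parity.GeneralizedHardyLittlewood.Theses.GoldbachHeathBrownDispersion.HeathBrownMorozUniform :=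
  heathBrownMorozUniform_of_classLemmas (h35_of_flDifferencing flDifferencing_holds)
    (h39_of_leadingDifferencing
      (classLeadingDifferencing_of_display104
        (h₄ classPairsTypeI_holds classTypeISqfreeSum_holds sigmaOneCoprime_holds))) h₅

/-- **The same from the class display (10.4) ITSELF** (the 0-ary form a worker may land: `ClassDisplay104` outright).
[cite: HeathBrownMoroz2004, Theorem 2] -/
theorem HeathBrownMorozUniform_of_display104 (h₄ : ClassDisplay104) (h₅ : ClassTypeIIBound) :
    Summit.Parity.GeneralizedHardyLittlewood.Theses.GoldbachHeathBrownDispersion.HeathBrownMorozUniform :=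
  HeathBrownMorozUniform_of (fun _ _ _ => h₄) h₅

/-- The v2-shaped composition is still available (a prover holding the v2 signature of S4b,
`ClassTypeISqfreeSum → ClassSigmaOneCoprime → ClassDisplay104`, closes the line too).
[cite: HeathBrownMoroz2004, Theorem 2] -/
theorem HeathBrownMorozUniform_of' (h₄ : ClassTypeISqfreeSum → ClassSigmaOneCoprime → ClassDisplay104)
    (h₅ : ClassTypeIIBound) :
    Summit.Parity.GeneralizedHardyLittlewood.Theses.GoldbachHeathBrownDispersion.HeathBrownMorozUniform :=
  HeathBrownMorozUniform_of (fun _ => h₄) h₅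

/-- **Union composition from the four v3/v4 stub signatures** (S4b; E3, E4, E5 — S4b and E3 are now theorems; kept so nothing typed against v3/v4 breaks).
[cite: HeathBrownMoroz2004, Theorem 2] -/
theorem HeathBrownMorozUniform_of_four
    (h₄ : ClassPairsTypeI → ClassTypeISqfreeSum → ClassSigmaOneCoprime → ClassDisplay104)
    (e3 : Sig.stub_classMainError) (e4 : Sig.stub_classMainCauchy) (e5 : Sig.stub_twistedSsum) :
    Summit.Parity.GeneralizedHardyLittlewood.Theses.GoldbachHeathBrownDispersion.HeathBrownMorozUniform :=
  HeathBrownMorozUniform_of h₄ (classTypeIIBound_of e3 e4 e5)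

/-- The v3-shaped six-hypothesis composition (kept so that nothing typed against v3 breaks; S3 and S4p are now
theorems and the two corresponding arguments are simply ignored). [cite: HeathBrownMoroz2004, Theorem 2] -/
theorem HeathBrownMorozUniform_of_six (_h₃ : ClassSigmaOneCoprime) (_h₄p : ClassPairsTypeI)
    (h₄ : ClassPairsTypeI → ClassTypeISqfreeSum → ClassSigmaOneCoprime → ClassDisplay104)
    (e3 : Sig.stub_classMainError) (e4 : Sig.stub_classMainCauchy) (e5 : Sig.stub_twistedSsum) :
    Summit.Parity.GeneralizedHardyLittlewood.Theses.GoldbachHeathBrownDispersion.HeathBrownMorozUniform :=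
  HeathBrownMorozUniform_of_four h₄ e3 e4 e5

/-- **Part A entirely discharged (v5): the crux from the class Type II bound ALONE.**
`h35 := h35_of_flDifferencing flDifferencing_holds`, `h39` from `classDisplay104_holds`; then
`heathBrownMorozUniform_of_classLemmas`. [cite: HeathBrownMoroz2004, Theorem 2] -/
theorem HeathBrownMorozUniform_of_typeII (h₅ : ClassTypeIIBound) :
    Summit.Parity.GeneralizedHardyLittlewood.Theses.GoldbachHeathBrownDispersion.HeathBrownMorozUniform :=
  heathBrownMorozUniform_of_classLemmas classH35_lemma_holds classH39_holds h₅

/-- **Union composition from EXACTLY the TWO remaining registered stub signatures BY NAME (v5): E4, E5**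
(E3 = `classMainError_holds`, Part A internal). [cite: HeathBrownMoroz2004, Theorem 2, Prop. 4.2] -/
theorem HeathBrownMorozUniform_of_two (e4 : Sig.stub_classMainCauchy) (e5 : Sig.stub_twistedSsum) :
    Summit.Parity.GeneralizedHardyLittlewood.Theses.GoldbachHeathBrownDispersion.HeathBrownMorozUniform :=
  HeathBrownMorozUniform_of_typeII (classTypeIIBound_of classMainError_holds e4 e5)

/-- **THE crux from the E5 signature BY NAME (v6 shape, kept): E5, the twisted dispersion bound**
(Part A, E3, E4 are theorems; as of v7 E5 is too — apply it to `twistedSsum_holds`). [cite: HeathBrownMoroz2004, Theorem 2, Prop. 4.2] [cite: HeathBrownActa2001, Lemma 12.2, §13] -/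
theorem HeathBrownMorozUniform_of_twisted (e5 : Sig.stub_twistedSsum) :
    Summit.Parity.GeneralizedHardyLittlewood.Theses.GoldbachHeathBrownDispersion.HeathBrownMorozUniform :=
  HeathBrownMorozUniform_of_two classMainCauchy_holds e5

/-- **The crux via the union skeleton — a sorry-free THEOREM as of v7** (E5 `twistedSsum_holds` landed; Part A of this
line and E3, E4 were theorems since v5/v6).  Its type is the crux decl BY NAME.  Goldbach is NOT proved by this: the crux
(Heath-Brown–Moroz 2004, Theorem 2 for `x³ + 2y³`) is one input of the FRONTIER formalisation rung `GoldbachHeathBrownDispersion`.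
[cite: HeathBrownMoroz2004, Theorem 2] -/
theorem heathBrownMorozUniform_via_line :
    Summit.Parity.GeneralizedHardyLittlewood.Theses.GoldbachHeathBrownDispersion.HeathBrownMorozUniform :=
  HeathBrownMorozUniform_of_twisted twistedSsum_holds

end Summit.Parity.GeneralizedHardyLittlewood.Cruxes.HeathBrownMorozUniform.ParentDifferencing

end
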